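import Mathlib
import HarnessLib
import Summits.ResolutionOfSingularities.ResolutionOfSingularities.Theorems.WildQuotientsWildQuotientResolutionS1aMemberChart
import Summits.ResolutionOfSingularities.ResolutionOfSingularities.Theorems.WildQuotientsWildQuotientResolutionS1aFreeModelStep
import Summits.ResolutionOfSingularities.ResolutionOfSingularities.Theorems.WildQuotientsWildQuotientResolutionS1aGraphTailLocal
import Summits.ResolutionOfSingularities.ResolutionOfSingularities.Theorems.WildQuotientsWildQuotientResolutionS1aGraphTailDeriv
import Summits.ResolutionOfSingularities.ResolutionOfSingularities.Theorems.WildQuotientsWildQuotientResolutionS1aGraphTailBricks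
import Summits.ResolutionOfSingularities.ResolutionOfSingularities.Theorems.WildQuotientsWildQuotientResolutionS1aTraceSections
import Summits.ResolutionOfSingularities.ResolutionOfSingularities.Theorems.WildQuotientsWildQuotientResolutionS1aQhAbsCover

/-!
# S1a — R4e LEVEL 2, PER CRITICAL POINT: the graph member on the producer chart `O′ᵢ₁` PRESENTED BY SECTIONS (`exists_graphTail_memberChart`)

[OURS · L1 W4.5c · lead-1 g17; plan-1 RULINGS R-F15q/r/s ★ R4e-rational `graphTail_killsIn_two`, SPEC §2 — per chart: the pinned free model
`Φ : ChartRing ≃ k[s, x′][1/q]` (✓`FreeModel.exists_chartFreeModelEquiv`, `q = subst hh · (∏ₗ (x′₁ + l x′₀ s^{m+1}))^{n₁}`), the unit `−∂₁G_q` and the `k`-point,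
then ✓`exists_principalCentreChart_of_graphChartAway`; the member generators `x′₀, φ` are replaced by their DEGREE-0 ASSOCIATES `a = x′₀·x′₁^{-(m+2)}`,
`b = φ·x′₁^{-(m+1)}` (✓`CoarseChart.exists_inv_pow_mem_of_isUnit`), honest sections of `O′ᵢ₁` with `a·(π^*(x₁−αᵢ))^{m+2} = π^*x₀`, `b·(π^*(x₁−αᵢ))^{m+1} = π^*t`,
and the transition sections of the two other producer charts factor through `a` resp. `b`] — NOT statements of the manuscript; counted 0; AI-level work, weaker than
expert review. Crux stmt-ResolutionOfSingularities-17941 `CyclicQuotientFourfolds`, line `s1a-logminvertex` v13 (`stub_reachLowerInFX`).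
-/

set_option linter.dupNamespace false

noncomputable section

open CategoryTheory Limits AlgebraicGeometry TopologicalSpace Topology Opposite MvPolynomial
open Literature.AlgebraicGeometry.Resolution Literature.AlgebraicGeometry.RelativeSpec
open scoped LaurentPolynomial
open Summit.ResolutionOfSingularities.ResolutionOfSingularities.Theorems.WildQuotientResolution.S1
open Summit.ResolutionOfSingularities.ResolutionOfSingularities.Theorems.WildQuotientResolution.S1.NodeAtlas
open Summit.ResolutionOfSingularities.ResolutionOfSingularities.Theorems.WildQuotientResolution.S1.ProducerStep
open Summit.ResolutionOfSingularities.ResolutionOfSingularities.Theorems.WildQuotientResolution.S1.CoarseChart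
open Summit.ResolutionOfSingularities.ResolutionOfSingularities.Theorems.WildQuotientResolution.S1.ReesBigrading
open Summit.ResolutionOfSingularities.ResolutionOfSingularities.Theorems.WildQuotientResolution.S1.NodeTransport
open Summit.ResolutionOfSingularities.ResolutionOfSingularities.Theorems.WildQuotientResolution.S1.CobordantTransport
open Summit.ResolutionOfSingularities.ResolutionOfSingularities.Theorems.WildQuotientResolution.S1.KillCert
open Summit.ResolutionOfSingularities.ResolutionOfSingularities.Theorems.WildQuotientResolution.S1.BlowupCharts
open Summit.ResolutionOfSingularities.ResolutionOfSingularities.Theorems.WildQuotientResolution.S1.NodeAway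
open Summit.ResolutionOfSingularities.ResolutionOfSingularities.Theorems.WildQuotientResolution.S1.CentreAway
open Summit.ResolutionOfSingularities.ResolutionOfSingularities.Theorems.WildQuotientResolution.S1.FreeModel

namespace Summit.ResolutionOfSingularities.ResolutionOfSingularities.Theorems.WildQuotientResolution.S1.ReesBigrading

section NatDeg

variable {ι : Type} [AddCommGroup ι] [DecidableEq ι] {B : Type} [CommRing B] (𝒜 : ι → AddSubgroup B) [GradedRing 𝒜]
  {c : ℕ} (f : Fin c → B) (w : Fin c → ℕ) {δ : Fin c → ι} (hf : ∀ i, f i ∈ 𝒜 (δ i))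

include hf in
/-- Pieces of bidegree `(n, 0)`, `n : ℕ`: products. [OURS · L1 W4.5c · bookkeeping] -/
theorem reesPiece_natDeg_mul {x y : ↥(cobordantAlgebra f w)} {a b c' : ℕ} (hx : x ∈ reesPiece 𝒜 f w ((a : ℤ), (0 : ι))) (hy : y ∈ reesPiece 𝒜 f w ((b : ℤ), (0 : ι)))
    (habc : a + b = c') : x * y ∈ reesPiece 𝒜 f w ((c' : ℤ), (0 : ι)) := by
  letI := reesGradedRing 𝒜 f w hf
  have h := SetLike.mul_mem_graded hx hy
  rwa [Prod.mk_add_mk, add_zero, ← Nat.cast_add, habc] at h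

include hf in
/-- Pieces of bidegree `(n, 0)`, `n : ℕ`: powers. [OURS · L1 W4.5c · bookkeeping] -/
theorem reesPiece_natDeg_pow {x : ↥(cobordantAlgebra f w)} {a c' : ℕ} (hx : x ∈ reesPiece 𝒜 f w ((a : ℤ), (0 : ι))) (n : ℕ) (hac : a * n = c') :
    x ^ n ∈ reesPiece 𝒜 f w ((c' : ℤ), (0 : ι)) := by
  letI := reesGradedRing 𝒜 f w hf
  have h := SetLike.pow_mem_graded n hx
  have e1 : n • (((a : ℕ) : ℤ), (0 : ι)) = (((c' : ℕ) : ℤ), (0 : ι)) :=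
    Prod.ext (by change n • ((a : ℕ) : ℤ) = _; rw [nsmul_eq_mul, ← hac]; push_cast; ring) (by rw [Prod.smul_snd, smul_zero])
  rwa [e1] at h

include hf in
/-- Pieces of bidegree `(n, 0)`, `n : ℕ`: finite products of elements of one piece. [OURS · L1 W4.5c · bookkeeping] -/
theorem reesPiece_natDeg_prod {κ : Type} (S : Finset κ) {x : κ → ↥(cobordantAlgebra f w)} {a c' : ℕ} (hx : ∀ j ∈ S, x j ∈ reesPiece 𝒜 f w ((a : ℤ), (0 : ι)))
    (hac : a * S.card = c') : ∏ j ∈ S, x j ∈ reesPiece 𝒜 f w ((c' : ℤ), (0 : ι)) := by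
  classical
  letI := reesGradedRing 𝒜 f w hf
  have h := SetLike.prod_mem_graded (A := reesPiece 𝒜 f w) (i := fun _ => (((a : ℕ) : ℤ), (0 : ι))) (g := x) (F := S) hx
  have e1 : ∑ _j ∈ S, (((a : ℕ) : ℤ), (0 : ι)) = (((c' : ℕ) : ℤ), (0 : ι)) := by
    rw [Finset.sum_const, Prod.ext_iff]
    exact ⟨by change S.card • ((a : ℕ) : ℤ) = _; rw [nsmul_eq_mul, ← hac]; push_cast; ring, by rw [Prod.smul_snd, smul_zero]⟩
  rwa [e1] at h

end NatDeg

end Summit.ResolutionOfSingularities.ResolutionOfSingularities.Theorems.WildQuotientResolution.S1.ReesBigrading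

namespace Summit.ResolutionOfSingularities.ResolutionOfSingularities.Theorems.WildQuotientResolution.S1.GameFrame.GModel

variable {p : ℕ} {X' X₁ : Scheme.{0}} {q : X' ⟶ X₁} {G : Type} [Group G] {ρ : G →* Aut X'} {g₀ : G}

set_option maxHeartbeats 8000000 in
set_option synthInstance.maxHeartbeats 400000 in
/-- ★★ **R4e LEVEL 2 PER CRITICAL POINT — the graph member on the producer chart, presented by sections.** See the module docstring.
[OURS · L1 W4.5c · R4e SPEC §2; NOT a statement of the manuscript] -/
theorem exists_graphTail_memberChart
    {k : Type} [Field k] [Fact p.Prime] [CharP k p] (σ : (MvPolynomial (Fin 4) k) ≃+* (MvPolynomial (Fin 4) k)) (hC : ∀ a : k, σ (C a) = C a)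
    (h0 : σ (X 0) = X 0) (h1 : σ (X 1) = X 1 + X 0) (h2 : σ (X 2) = X 2) (m : ℕ) (wl : Polynomial k) (h3 : σ (X 3) = X 3 + (X 2 - X 1 ^ (m + 1) * Polynomial.aeval (X 1 : MvPolynomial (Fin 4) k) wl : MvPolynomial (Fin 4) k))
    {ιs : Type} (s : Finset ιs) (cs : ιs → k) (hcs : ∀ j ∈ s, cs j ≠ 0) (mm : ιs → ℕ) (c₀ : k) (hc₀ : c₀ ≠ 0)
    (hwl : ((m + 1 : ℕ) : Polynomial k) * wl + Polynomial.X * Polynomial.derivative wl = Polynomial.C c₀ * ∏ j ∈ s, (Polynomial.X + Polynomial.C (cs j)) ^ mm j)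
    (hh : (MvPolynomial (Fin 4) k)) (hhh : hh = ∏ j ∈ s, ∏ l : ZMod p, (X 1 + C (cs j) + (l.val : (MvPolynomial (Fin 4) k)) * X 0)) (hσh : σ hh = hh)
    (hp : 0 < p) (hσpL : ∀ y : (Localization.Away hh), (⇑(sigmaAway σ hσh))^[p] y = y)
    (hσJ : ∀ n : ℕ, ((weightedFiltration (fun i => algebraMap (MvPolynomial (Fin 4) k) (Localization.Away hh) (X ((![0, 1, 2] : Fin 3 → Fin 4) i))) (![m + 2, 1, m + 1] : Fin 3 → ℕ)).ideal n).map ((sigmaAway σ hσh) : (Localization.Away hh) →+* (Localization.Away hh)) ≤ (weightedFiltration (fun i => algebraMap (MvPolynomial (Fin 4) k) (Localization.Away hh) (X ((![0, 1, 2] : Fin 3 → Fin 4) i))) (![m + 2, 1, m + 1] : Fin 3 → ℕ)).ideal n)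
    (ht : algebraMap (MvPolynomial (Fin 4) k) (Localization.Away hh) (X 2 - X 1 ^ (m + 1) * Polynomial.aeval (X 1 : MvPolynomial (Fin 4) k) wl : MvPolynomial (Fin 4) k) ∈ (weightedFiltration (fun i => algebraMap (MvPolynomial (Fin 4) k) (Localization.Away hh) (X ((![0, 1, 2] : Fin 3 → Fin 4) i))) (![m + 2, 1, m + 1] : Fin 3 → ℕ)).ideal (m + 1))
    {mg : ℕ} (mo : Fin mg → ℕ) (𝒜 : (Π j : Fin mg, ZMod (mo j)) → AddSubgroup (Localization.Away hh)) [GradedRing 𝒜] (h𝒜 : ∀ x : (Localization.Away hh), x ∈ 𝒜 0)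
    (hf : ∀ i, (fun i => algebraMap (MvPolynomial (Fin 4) k) (Localization.Away hh) (X ((![0, 1, 2] : Fin 3 → Fin 4) i))) i ∈ 𝒜 ((fun _ => (0 : Π j : Fin mg, ZMod (mo j))) i))
    {dbar : ℕ} (y : ↥(𝒜 0)) (hy : y ∈ (traceFiltration 𝒜 (fun i => algebraMap (MvPolynomial (Fin 4) k) (Localization.Away hh) (X ((![0, 1, 2] : Fin 3 → Fin 4) i))) (![m + 2, 1, m + 1] : Fin 3 → ℕ)).ideal dbar) (hσy : (sigmaAway σ hσh) (y : (Localization.Away hh)) = y)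
    {n₁ : ℕ} (hn₁ : 0 < n₁)
    (hc1 : (coverElement 𝒜 (fun i => algebraMap (MvPolynomial (Fin 4) k) (Localization.Away hh) (X ((![0, 1, 2] : Fin 3 → Fin 4) i))) (![m + 2, 1, m + 1] : Fin 3 → ℕ) dbar y hy) = (∏ l : ZMod p, (cobordantAlgebra.u' (fun i => algebraMap (MvPolynomial (Fin 4) k) (Localization.Away hh) (X ((![0, 1, 2] : Fin 3 → Fin 4) i))) (![m + 2, 1, m + 1] : Fin 3 → ℕ) 1 + algebraMap (Localization.Away hh) ↥(cobordantAlgebra (fun i => algebraMap (MvPolynomial (Fin 4) k) (Localization.Away hh) (X ((![0, 1, 2] : Fin 3 → Fin 4) i))) (![m + 2, 1, m + 1] : Fin 3 → ℕ)) (l.val : (Localization.Away hh)) * (cobordantAlgebra.u' (fun i => algebraMap (MvPolynomial (Fin 4) k) (Localization.Away hh) (X ((![0, 1, 2] : Fin 3 → Fin 4) i))) (![m + 2, 1, m + 1] : Fin 3 → ℕ) 0 * cobordantAlgebra.s (fun i => algebraMap (MvPolynomial (Fin 4) k) (Localization.Away hh) (X ((![0, 1, 2] : Fin 3 → Fin 4)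 i))) (![m + 2, 1, m + 1] : Fin 3 → ℕ) ^ (m + 1)))) ^ n₁)
    -- the chart and its producer node
    (M : GModel p q G ρ g₀) [M.V.IsSeparated] (W : M.act.StableAffineOpens) (hW : IsAffineOpen W.1)
    (E : letI := chartNodeGradedRing mo 𝒜 (fun i => algebraMap (MvPolynomial (Fin 4) k) (Localization.Away hh) (X ((![0, 1, 2] : Fin 3 → Fin 4) i))) (![m + 2, 1, m + 1] : Fin 3 → ℕ) hf dbar y hy; Γ(M.V, W.1) ≃+* ↥((chartNodeGrading mo 𝒜 (fun i => algebraMap (MvPolynomial (Fin 4) k) (Localization.Away hh) (X ((![0, 1, 2] : Fin 3 → Fin 4) i))) (![m + 2, 1, m + 1] : Fin 3 → ℕ) hf dbar y hy) 0))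
    (htame : letI := chartNodeGradedRing mo 𝒜 (fun i => algebraMap (MvPolynomial (Fin 4) k) (Localization.Away hh) (X ((![0, 1, 2] : Fin 3 → Fin 4) i))) (![m + 2, 1, m + 1] : Fin 3 → ℕ) hf dbar y hy; IsTameNode p (ChartRing 𝒜 (fun i => algebraMap (MvPolynomial (Fin 4) k) (Localization.Away hh) (X ((![0, 1, 2] : Fin 3 → Fin 4) i))) (![m + 2, 1, m + 1] : Fin 3 → ℕ) dbar y hy) (chartNodeGrading mo 𝒜 (fun i => algebraMap (MvPolynomial (Fin 4) k) (Localization.Away hh) (X ((![0, 1, 2] : Fin 3 → Fin 4) i))) (![m + 2, 1, m + 1] : Fin 3 → ℕ) hf dbar y hy) (sigmaChart 𝒜 (fun i => algebraMap (MvPolynomial (Fin 4) k) (Localization.Away hh) (X ((![0, 1, 2] : Fin 3 → Fin 4) i))) (![m + 2, 1, m + 1] : Fin 3 → ℕ) dbar y hy (sigmaAway σ hσh) hσJ hp hσpL hσy))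
    (hE : letI := chartNodeGradedRing mo 𝒜 (fun i => algebraMap (MvPolynomial (Fin 4) k) (Localization.Away hh) (X ((![0, 1, 2] : Fin 3 → Fin 4) i))) (![m + 2, 1, m + 1] : Fin 3 → ℕ) hf dbar y hy
      ∀ t' : Γ(M.V, W.1), ((E ((M.act.aut g₀⁻¹).hom.appLE W.1 W.1 (W.2.1 g₀⁻¹).ge t') : ↥((chartNodeGrading mo 𝒜 (fun i => algebraMap (MvPolynomial (Fin 4) k) (Localization.Away hh) (X ((![0, 1, 2] : Fin 3 → Fin 4) i))) (![m + 2, 1, m + 1] : Fin 3 → ℕ) hf dbar y hy) 0)) : (ChartRing 𝒜 (fun i => algebraMap (MvPolynomial (Fin 4) k) (Localization.Away hh) (X ((![0, 1, 2] : Fin 3 → Fin 4) i))) (![m + 2, 1, m + 1] : Fin 3 → ℕ) dbar y hy)) = (sigmaChart 𝒜 (fun i => algebraMap (MvPolynomial (Fin 4) k) (Localization.Away hh) (X ((![0, 1, 2] : Fin 3 → Fin 4) i))) (![m + 2, 1, m + 1] : Fin 3 → ℕ) dbar y hy (sigmaAway σ hσh) hσJ hp hσpL hσy) ((E t' : ↥((chartNodeGrading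 mo 𝒜 (fun i => algebraMap (MvPolynomial (Fin 4) k) (Localization.Away hh) (X ((![0, 1, 2] : Fin 3 → Fin 4) i))) (![m + 2, 1, m + 1] : Fin 3 → ℕ) hf dbar y hy) 0)) : (ChartRing 𝒜 (fun i => algebraMap (MvPolynomial (Fin 4) k) (Localization.Away hh) (X ((![0, 1, 2] : Fin 3 → Fin 4) i))) (![m + 2, 1, m + 1] : Fin 3 → ℕ) dbar y hy)))
    -- the pulled-back root sections and the transition sections, by their values in the chart ring
    (r0 r1 rt z0 z2 : Γ(M.V, W.1))
    (hr0 : letI := chartNodeGradedRing mo 𝒜 (fun i => algebraMap (MvPolynomial (Fin 4) k) (Localization.Away hh) (X ((![0, 1, 2] : Fin 3 → Fin 4) i))) (![m + 2, 1, m + 1] : Fin 3 → ℕ) hf dbar y hy; ((E r0 : ↥((chartNodeGrading mo 𝒜 (fun i => algebraMap (MvPolynomial (Fin 4) k) (Localization.Away hh) (X ((![0, 1, 2] : Fin 3 → Fin 4) i))) (![m + 2, 1, m + 1] : Fin 3 → ℕ) hf dbar y hy) 0)) : (ChartRing 𝒜 (fun i => algebraMap (MvPolynomial (Fin 4) k)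 (Localization.Away hh) (X ((![0, 1, 2] : Fin 3 → Fin 4) i))) (![m + 2, 1, m + 1] : Fin 3 → ℕ) dbar y hy)) = algebraMap ↥(cobordantAlgebra (fun i => algebraMap (MvPolynomial (Fin 4) k) (Localization.Away hh) (X ((![0, 1, 2] : Fin 3 → Fin 4) i))) (![m + 2, 1, m + 1] : Fin 3 → ℕ)) (ChartRing 𝒜 (fun i => algebraMap (MvPolynomial (Fin 4) k) (Localization.Away hh) (X ((![0, 1, 2] : Fin 3 → Fin 4) i))) (![m + 2, 1, m + 1] : Fin 3 → ℕ) dbar y hy) (algebraMap (Localization.Away hh) ↥(cobordantAlgebra (fun i => algebraMap (MvPolynomial (Fin 4) k) (Localization.Away hh) (X ((![0, 1, 2] : Fin 3 → Fin 4) i))) (![m + 2, 1, m + 1] : Fin 3 → ℕ)) ((fun i => algebraMap (MvPolynomial (Fin 4) k) (Localization.Away hh) (X ((![0, 1, 2] : Fin 3 → Fin 4) i))) 0)))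
    (hr1 : letI := chartNodeGradedRing mo 𝒜 (fun i => algebraMap (MvPolynomial (Fin 4) k) (Localization.Away hh) (X ((![0, 1, 2] : Fin 3 → Fin 4) i))) (![m + 2, 1, m + 1] : Fin 3 → ℕ) hf dbar y hy; ((E r1 : ↥((chartNodeGrading mo 𝒜 (fun i => algebraMap (MvPolynomial (Fin 4) k) (Localization.Away hh) (X ((![0, 1, 2] : Fin 3 → Fin 4) i))) (![m + 2, 1, m + 1] : Fin 3 → ℕ) hf dbar y hy) 0)) : (ChartRing 𝒜 (fun i => algebraMap (MvPolynomial (Fin 4) k) (Localization.Away hh) (X ((![0, 1, 2] : Fin 3 → Fin 4) i))) (![m + 2, 1, m + 1] : Fin 3 → ℕ) dbar y hy)) = algebraMap ↥(cobordantAlgebra (fun i => algebraMap (MvPolynomial (Fin 4) k) (Localization.Away hh) (X ((![0, 1, 2] : Fin 3 → Fin 4) i))) (![m + 2, 1, m + 1] : Fin 3 → ℕ)) (ChartRing 𝒜 (fun i => algebraMap (MvPolynomial (Fin 4) k) (Localization.Away hh) (X ((![0, 1, 2] : Fin 3 → Fin 4) i))) (![m + 2, 1, m + 1] : Fin 3 →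 ℕ) dbar y hy) (algebraMap (Localization.Away hh) ↥(cobordantAlgebra (fun i => algebraMap (MvPolynomial (Fin 4) k) (Localization.Away hh) (X ((![0, 1, 2] : Fin 3 → Fin 4) i))) (![m + 2, 1, m + 1] : Fin 3 → ℕ)) ((fun i => algebraMap (MvPolynomial (Fin 4) k) (Localization.Away hh) (X ((![0, 1, 2] : Fin 3 → Fin 4) i))) 1)))
    (hrt : letI := chartNodeGradedRing mo 𝒜 (fun i => algebraMap (MvPolynomial (Fin 4) k) (Localization.Away hh) (X ((![0, 1, 2] : Fin 3 → Fin 4) i))) (![m + 2, 1, m + 1] : Fin 3 → ℕ) hf dbar y hy; ((E rt : ↥((chartNodeGrading mo 𝒜 (fun i => algebraMap (MvPolynomial (Fin 4) k) (Localization.Away hh) (X ((![0, 1, 2] : Fin 3 → Fin 4) i))) (![m + 2, 1, m + 1] : Fin 3 → ℕ) hf dbar y hy) 0)) : (ChartRing 𝒜 (fun i => algebraMap (MvPolynomial (Fin 4) k) (Localization.Away hh) (X ((![0, 1, 2] : Fin 3 → Fin 4) i))) (![m + 2, 1, m + 1] : Fin 3 → ℕ) dbar y hy)) = algebraMap ↥(cobordantAlgebra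 (fun i => algebraMap (MvPolynomial (Fin 4) k) (Localization.Away hh) (X ((![0, 1, 2] : Fin 3 → Fin 4) i))) (![m + 2, 1, m + 1] : Fin 3 → ℕ)) (ChartRing 𝒜 (fun i => algebraMap (MvPolynomial (Fin 4) k) (Localization.Away hh) (X ((![0, 1, 2] : Fin 3 → Fin 4) i))) (![m + 2, 1, m + 1] : Fin 3 → ℕ) dbar y hy) (algebraMap (Localization.Away hh) ↥(cobordantAlgebra (fun i => algebraMap (MvPolynomial (Fin 4) k) (Localization.Away hh) (X ((![0, 1, 2] : Fin 3 → Fin 4) i))) (![m + 2, 1, m + 1] : Fin 3 → ℕ)) (algebraMap (MvPolynomial (Fin 4) k) (Localization.Away hh) (X 2 - X 1 ^ (m + 1) * Polynomial.aeval (X 1 : MvPolynomial (Fin 4) k) wl : MvPolynomial (Fin 4) k))))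
    {n₀ : ℕ} (hd₀ : dbar = (m + 2) * n₀)
    (hz0 : letI := chartNodeGradedRing mo 𝒜 (fun i => algebraMap (MvPolynomial (Fin 4) k) (Localization.Away hh) (X ((![0, 1, 2] : Fin 3 → Fin 4) i))) (![m + 2, 1, m + 1] : Fin 3 → ℕ) hf dbar y hy
      ((E z0 : ↥((chartNodeGrading mo 𝒜 (fun i => algebraMap (MvPolynomial (Fin 4) k) (Localization.Away hh) (X ((![0, 1, 2] : Fin 3 → Fin 4) i))) (![m + 2, 1, m + 1] : Fin 3 → ℕ) hf dbar y hy) 0)) : (ChartRing 𝒜 (fun i => algebraMap (MvPolynomial (Fin 4) k) (Localization.Away hh) (X ((![0, 1, 2] : Fin 3 → Fin 4) i))) (![m + 2, 1, m + 1] : Fin 3 → ℕ) dbar y hy)) = algebraMap ↥(cobordantAlgebra (fun i => algebraMap (MvPolynomial (Fin 4) k) (Localization.Away hh) (X ((![0, 1, 2] : Fin 3 → Fin 4) i))) (![m + 2, 1, m + 1] : Fin 3 → ℕ)) (ChartRing 𝒜 (fun i => algebraMap (MvPolynomial (Fin 4) k) (Localization.Away hh) (X ((![0, 1, 2] : Fin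 3 → Fin 4) i))) (![m + 2, 1, m + 1] : Fin 3 → ℕ) dbar y hy) (cobordantAlgebra.u' (fun i => algebraMap (MvPolynomial (Fin 4) k) (Localization.Away hh) (X ((![0, 1, 2] : Fin 3 → Fin 4) i))) (![m + 2, 1, m + 1] : Fin 3 → ℕ) 0 ^ n₀) * IsLocalization.Away.invSelf (coverElement 𝒜 (fun i => algebraMap (MvPolynomial (Fin 4) k) (Localization.Away hh) (X ((![0, 1, 2] : Fin 3 → Fin 4) i))) (![m + 2, 1, m + 1] : Fin 3 → ℕ) dbar y hy))
    {n₂ : ℕ} (hn₂ : 0 < n₂) (hd₂ : dbar = (m + 1) * p * n₂)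
    (hz2 : letI := chartNodeGradedRing mo 𝒜 (fun i => algebraMap (MvPolynomial (Fin 4) k) (Localization.Away hh) (X ((![0, 1, 2] : Fin 3 → Fin 4) i))) (![m + 2, 1, m + 1] : Fin 3 → ℕ) hf dbar y hy
      ((E z2 : ↥((chartNodeGrading mo 𝒜 (fun i => algebraMap (MvPolynomial (Fin 4) k) (Localization.Away hh) (X ((![0, 1, 2] : Fin 3 → Fin 4) i))) (![m + 2, 1, m + 1] : Fin 3 → ℕ) hf dbar y hy) 0)) : (ChartRing 𝒜 (fun i => algebraMap (MvPolynomial (Fin 4) k) (Localization.Away hh) (X ((![0, 1, 2] : Fin 3 → Fin 4) i))) (![m + 2, 1, m + 1] : Fin 3 → ℕ) dbar y hy)) = algebraMap ↥(cobordantAlgebra (fun i => algebraMap (MvPolynomial (Fin 4) k) (Localization.Away hh) (X ((![0, 1, 2] : Fin 3 → Fin 4) i))) (![m + 2, 1, m + 1] : Fin 3 → ℕ)) (ChartRing 𝒜 (fun i => algebraMap (MvPolynomial (Fin 4) k) (Localization.Away hh) (X ((![0, 1, 2] : Fin 3 → Fin 4) i))) (![m + 2, 1, m + 1] : Fin 3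 → ℕ) dbar y hy) ((∏ j : ZMod p, (⇑(sigmaR (sigmaAway σ hσh) (fun i => algebraMap (MvPolynomial (Fin 4) k) (Localization.Away hh) (X ((![0, 1, 2] : Fin 3 → Fin 4) i))) (![m + 2, 1, m + 1] : Fin 3 → ℕ) hσJ hp hσpL))^[j.val] (⟨_, C_mul_T_mem_cobordantAlgebra _ _ ht⟩ : ↥(cobordantAlgebra (fun i => algebraMap (MvPolynomial (Fin 4) k) (Localization.Away hh) (X ((![0, 1, 2] : Fin 3 → Fin 4) i))) (![m + 2, 1, m + 1] : Fin 3 → ℕ)))) ^ n₂) * IsLocalization.Away.invSelf (coverElement 𝒜 (fun i => algebraMap (MvPolynomial (Fin 4) k) (Localization.Away hh) (X ((![0, 1, 2] : Fin 3 → Fin 4) i))) (![m + 2, 1, m + 1] : Fin 3 → ℕ) dbar y hy)) :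
    ∃ (a b : Γ(M.V, W.1)), a * r1 ^ (m + 2) = r0 ∧ b * r1 ^ (m + 1) = rt ∧
      (∀ v ∈ W.1, v ∈ M.V.basicOpen z0 → v ∈ M.V.basicOpen a) ∧ (∀ v ∈ W.1, v ∈ M.V.basicOpen z2 → v ∈ M.V.basicOpen b) ∧
      ∃ d₀ : ℕ, 0 < d₀ ∧ ∀ l : ℕ, 0 < l → ∃ 𝒦₀ : ReesFiltration M.V, IsPrincipalCentreChart p M.act g₀ 𝒦₀ (d₀ * l) W ∧
        ∀ (U : M.V.affineOpens) (hU : U.1 ≤ W.1) (n : ℕ), (𝒦₀.filtration U).ideal n =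
          (weightedFiltration (fun l' => (M.V.presheaf.map (homOfLE hU).op).hom ((![a, b] : Fin 2 → Γ(M.V, W.1)) l')) ![2, 1]).ideal n := by
  classical
  letI instN := chartNodeGradedRing mo 𝒜 (fun i => algebraMap (MvPolynomial (Fin 4) k) (Localization.Away hh) (X ((![0, 1, 2] : Fin 3 → Fin 4) i))) (![m + 2, 1, m + 1] : Fin 3 → ℕ) hf dbar y hy
  haveI : NeZero p := ⟨hp.ne'⟩
  have hp1 : p ≠ 1 := (Fact.out : p.Prime).ne_one
  have hw0 : (![m + 2, 1, m + 1] : Fin 3 → ℕ) 0 = (![m + 2, 1, m + 1] : Fin 3 → ℕ) 1 + (m + 1) := by change m + 2 = 1 + (m + 1); ring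
  have ht0A : algebraMap (MvPolynomial (Fin 4) k) (Localization.Away hh) (X 2 - X 1 ^ (m + 1) * Polynomial.aeval (X 1 : MvPolynomial (Fin 4) k) wl : MvPolynomial (Fin 4) k) ∈ 𝒜 0 := h𝒜 _
  -- `hh ≠ 0`, characteristic, the chart polynomial `q = subst hh · z`
  have hh0 : hh ≠ 0 := fun h => by
    have := GraphTail.eval_locPoly_ne_zero (p := p) s cs hcs (fun _ => (0 : k)) rfl rfl
    rw [← hhh, h, map_zero] at this
    exact this rfl
  -- ### the pinned free model of the producer chart ring
  have hvW : ∀ i : Fin 3, (![m + 2, 1, m + 1, 0] : Fin 4 → ℕ) ((![0, 1, 2] : Fin 3 → Fin 4) i) = (![m + 2, 1, m + 1] : Fin 3 → ℕ) i := fun i => by fin_cases i <;> rfl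
  have hWv : ∀ l : Fin 4, (![m + 2, 1, m + 1, 0] : Fin 4 → ℕ) l = 0 ∨ ∃ i : Fin 3, (![0, 1, 2] : Fin 3 → Fin 4) i = l := fun l => by
    fin_cases l
    exacts [Or.inr ⟨0, rfl⟩, Or.inr ⟨1, rfl⟩, Or.inr ⟨2, rfl⟩, Or.inl rfl]
  have hz : ∀ Ψ : ↥(cobordantAlgebra (fun i => algebraMap (MvPolynomial (Fin 4) k) (Localization.Away hh) (X ((![0, 1, 2] : Fin 3 → Fin 4) i))) (![m + 2, 1, m + 1] : Fin 3 → ℕ)) ≃+* Localization.Away (cobordantAlgebra.subst k (![m + 2, 1, m + 1, 0] : Fin 4 → ℕ) hh),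
      (∀ a : (MvPolynomial (Fin 4) k), Ψ (algebraMap (Localization.Away hh) ↥(cobordantAlgebra (fun i => algebraMap (MvPolynomial (Fin 4) k) (Localization.Away hh) (X ((![0, 1, 2] : Fin 3 → Fin 4) i))) (![m + 2, 1, m + 1] : Fin 3 → ℕ)) (algebraMap (MvPolynomial (Fin 4) k) (Localization.Away hh) a)) = algebraMap (MvPolynomial (Option (Fin 4)) k) _ (cobordantAlgebra.subst k (![m + 2, 1, m + 1, 0] : Fin 4 → ℕ) a)) →
      Ψ (cobordantAlgebra.s (fun i => algebraMap (MvPolynomial (Fin 4) k) (Localization.Away hh) (X ((![0, 1, 2] : Fin 3 → Fin 4) i))) (![m + 2, 1, m + 1] : Fin 3 → ℕ)) = algebraMap (MvPolynomial (Option (Fin 4)) k) _ (X none) →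
      (∀ i, Ψ (cobordantAlgebra.u' (fun i => algebraMap (MvPolynomial (Fin 4) k) (Localization.Away hh) (X ((![0, 1, 2] : Fin 3 → Fin 4) i))) (![m + 2, 1, m + 1] : Fin 3 → ℕ) i) = algebraMap (MvPolynomial (Option (Fin 4)) k) _ (X (some ((![0, 1, 2] : Fin 3 → Fin 4) i)))) →
      Associated (algebraMap (MvPolynomial (Option (Fin 4)) k) (Localization.Away (cobordantAlgebra.subst k (![m + 2, 1, m + 1, 0] : Fin 4 → ℕ) hh)) ((∏ l : ZMod p, (X (some 1) + (l.val : (MvPolynomial (Option (Fin 4)) k)) * (X (some 0) * X none ^ (m + 1)))) ^ n₁)) (Ψ (coverElement 𝒜 (fun i => algebraMap (MvPolynomial (Fin 4) k) (Localization.Away hh) (X ((![0, 1, 2] : Fin 3 → Fin 4) i))) (![m + 2, 1, m + 1] : Fin 3 → ℕ) dbar y hy)) := by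
    intro Ψ hΨa hΨs hΨu
    have hl : ∀ l : ZMod p, Ψ (algebraMap (Localization.Away hh) ↥(cobordantAlgebra (fun i => algebraMap (MvPolynomial (Fin 4) k) (Localization.Away hh) (X ((![0, 1, 2] : Fin 3 → Fin 4) i))) (![m + 2, 1, m + 1] : Fin 3 → ℕ)) (l.val : (Localization.Away hh))) = (l.val : Localization.Away (cobordantAlgebra.subst k (![m + 2, 1, m + 1, 0] : Fin 4 → ℕ) hh)) := fun l => by
      rw [map_natCast, map_natCast]
    have heq : Ψ (coverElement 𝒜 (fun i => algebraMap (MvPolynomial (Fin 4) k) (Localization.Away hh) (X ((![0, 1, 2] : Fin 3 → Fin 4) i))) (![m + 2, 1, m + 1] : Fin 3 → ℕ) dbar y hy) = algebraMap (MvPolynomial (Option (Fin 4)) k) (Localization.Away (cobordantAlgebra.subst k (![m + 2, 1, m + 1, 0] : Fin 4 → ℕ) hh)) ((∏ l : ZMod p, (X (some 1) + (l.val : (MvPolynomial (Option (Fin 4)) k)) * (X (some 0) * X none ^ (m + 1)))) ^ n₁) := by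
      rw [hc1, map_pow, map_prod, map_pow, map_prod]
      refine congrArg (· ^ n₁) (Finset.prod_congr rfl fun l _ => ?_)
      rw [map_add, map_mul, map_mul, map_pow, hΨu 1, hΨu 0, hΨs, hl, map_add, map_mul, map_mul, map_pow, map_natCast]
      rfl
    rw [heq]
  obtain ⟨Φ, hΦa, hΦs, hΦu⟩ := FreeModel.exists_chartFreeModelEquiv k (![m + 2, 1, m + 1, 0] : Fin 4 → ℕ) hh (![0, 1, 2] : Fin 3 → Fin 4) (![m + 2, 1, m + 1] : Fin 3 → ℕ) hvW hWv (fun i => algebraMap (MvPolynomial (Fin 4) k) (Localization.Away hh) (X ((![0, 1, 2] : Fin 3 → Fin 4) i))) (fun _ => rfl) 𝒜 dbar y hy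
    ((∏ l : ZMod p, (X (some 1) + (l.val : (MvPolynomial (Option (Fin 4)) k)) * (X (some 0) * X none ^ (m + 1)))) ^ n₁) hz
  letI instP := mapGradedRing (chartNodeGrading mo 𝒜 (fun i => algebraMap (MvPolynomial (Fin 4) k) (Localization.Away hh) (X ((![0, 1, 2] : Fin 3 → Fin 4) i))) (![m + 2, 1, m + 1] : Fin 3 → ℕ) hf dbar y hy) Φ
  -- ### the chart polynomial `q = subst hh · z ^ n₁`
  have hsubX : ∀ i : Fin 4, cobordantAlgebra.subst k (![m + 2, 1, m + 1, 0] : Fin 4 → ℕ) (X i) = X none ^ (![m + 2, 1, m + 1, 0] : Fin 4 → ℕ) i * X (some i) := fun i => by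
    rw [cobordantAlgebra.subst, MvPolynomial.eval₂Hom_X']
  have hsubC : ∀ a : k, cobordantAlgebra.subst k (![m + 2, 1, m + 1, 0] : Fin 4 → ℕ) (C a) = C a := fun a => by rw [cobordantAlgebra.subst, MvPolynomial.eval₂Hom_C]
  have hsubst_hh : cobordantAlgebra.subst k (![m + 2, 1, m + 1, 0] : Fin 4 → ℕ) hh = ∏ j ∈ s, ∏ l : ZMod p, (X none * X (some 1) + C (cs j) + (l.val : (MvPolynomial (Option (Fin 4)) k)) * (X none ^ (m + 2) * X (some 0))) := by
    rw [hhh, map_prod]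
    refine Finset.prod_congr rfl fun j _ => ?_
    rw [map_prod]
    refine Finset.prod_congr rfl fun l _ => ?_
    rw [map_add, map_add, map_mul, map_natCast, hsubX, hsubX, hsubC]
    simp only [Matrix.cons_val_one, Matrix.cons_val_zero, pow_one]
  -- the `k`-point `(s, x′₀, x′₁, x′₂, x₃) = (0, 0, 1, G_q(0,1), 0)`
  have hu : MvPolynomial.eval (fun o : Option (Fin 4) => o.elim (0 : k) ![0, 1, MvPolynomial.eval ![0, 1] (X 1 ^ (m + 1) * Polynomial.aeval (X 0 * X 1 : MvPolynomial (Fin 2) k) wl : MvPolynomial (Fin 2) k), 0]) (cobordantAlgebra.subst k (![m + 2, 1, m + 1, 0] : Fin 4 → ℕ) hh * (∏ l : ZMod p, (X (some 1) + (l.val : (MvPolynomial (Option (Fin 4)) k)) * (X (some 0) * X none ^ (m + 1)))) ^ n₁) ≠ 0 := by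
    rw [map_mul, map_pow, hsubst_hh, map_prod, map_prod]
    simp only [map_prod, map_add, map_mul, map_natCast, map_pow, MvPolynomial.eval_X, MvPolynomial.eval_C, Option.elim_none, Option.elim_some,
      Matrix.cons_val_zero, Matrix.cons_val_one, mul_zero, zero_add, add_zero, mul_one, zero_pow (Nat.succ_ne_zero _),
      Finset.prod_const_one, one_pow]
    exact Finset.prod_ne_zero_iff.mpr fun j hj => Finset.prod_ne_zero_iff.mpr fun l _ => hcs j hj
  have hq0 : (cobordantAlgebra.subst k (![m + 2, 1, m + 1, 0] : Fin 4 → ℕ) hh * (∏ l : ZMod p, (X (some 1) + (l.val : (MvPolynomial (Option (Fin 4)) k)) * (X (some 0) * X none ^ (m + 1)))) ^ n₁) ≠ 0 := fun h => hu (by rw [h, map_zero])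
  haveI : IsDomain (Localization.Away (cobordantAlgebra.subst k (![m + 2, 1, m + 1, 0] : Fin 4 → ℕ) hh * (∏ l : ZMod p, (X (some 1) + (l.val : (MvPolynomial (Option (Fin 4)) k)) * (X (some 0) * X none ^ (m + 1)))) ^ n₁)) := IsLocalization.isDomain_localization (powers_le_nonZeroDivisors_of_noZeroDivisors hq0)
  haveI : CharP (Localization.Away (cobordantAlgebra.subst k (![m + 2, 1, m + 1, 0] : Fin 4 → ℕ) hh * (∏ l : ZMod p, (X (some 1) + (l.val : (MvPolynomial (Option (Fin 4)) k)) * (X (some 0) * X none ^ (m + 1)))) ^ n₁)) p := charP_of_injective_ringHom (IsLocalization.injective (Localization.Away (cobordantAlgebra.subst k (![m + 2, 1, m + 1, 0] : Fin 4 → ℕ) hh * (∏ l : ZMod p, (X (some 1) + (l.val : (MvPolynomial (Option (Fin 4)) k)) * (X (some 0) * X none ^ (m + 1)))) ^ n₁)) (powers_le_nonZeroDivisors_of_noZeroDivisors hq0)) p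
  -- divisors of `q` are units on the chart
  have hZP1 : (X (some 1) : (MvPolynomial (Option (Fin 4)) k)) ∣ (∏ l : ZMod p, (X (some 1) + (l.val : (MvPolynomial (Option (Fin 4)) k)) * (X (some 0) * X none ^ (m + 1)))) := by
    have h := Finset.dvd_prod_of_mem (fun l : ZMod p => (X (some 1) + (l.val : (MvPolynomial (Option (Fin 4)) k)) * (X (some 0) * X none ^ (m + 1)))) (Finset.mem_univ (0 : ZMod p))
    rwa [ZMod.val_zero, Nat.cast_zero, zero_mul, add_zero] at h
  have hunit_of_dvd : ∀ a : (MvPolynomial (Option (Fin 4)) k), a ∣ (cobordantAlgebra.subst k (![m + 2, 1, m + 1, 0] : Fin 4 → ℕ) hh * (∏ l : ZMod p, (X (some 1) + (l.val : (MvPolynomial (Option (Fin 4)) k)) * (X (some 0) * X none ^ (m + 1)))) ^ n₁) → IsUnit ((algebraMap (MvPolynomial (Option (Fin 4)) k) (Localization.Away (cobordantAlgebra.subst k (![m + 2, 1, m + 1, 0] : Fin 4 → ℕ) hh * (∏ l : ZMod p, (X (some 1) + (l.val : (MvPolynomial (Option (Fin 4)) k)) * (X (some 0) * X none ^ (m +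 1)))) ^ n₁))) a) := fun a ha =>
    (IsLocalization.Away.algebraMap_isUnit_iff (cobordantAlgebra.subst k (![m + 2, 1, m + 1, 0] : Fin 4 → ℕ) hh * (∏ l : ZMod p, (X (some 1) + (l.val : (MvPolynomial (Option (Fin 4)) k)) * (X (some 0) * X none ^ (m + 1)))) ^ n₁)).mpr ⟨1, by rw [pow_one]; exact ha⟩
  have hX1unit : IsUnit ((algebraMap (MvPolynomial (Option (Fin 4)) k) (Localization.Away (cobordantAlgebra.subst k (![m + 2, 1, m + 1, 0] : Fin 4 → ℕ) hh * (∏ l : ZMod p, (X (some 1) + (l.val : (MvPolynomial (Option (Fin 4)) k)) * (X (some 0) * X none ^ (m + 1)))) ^ n₁))) (X (some 1))) := hunit_of_dvd _ (Dvd.dvd.mul_left (hZP1.trans (dvd_pow_self _ hn₁.ne')) _)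
  have hfacunit : ∀ j ∈ s, IsUnit ((algebraMap (MvPolynomial (Option (Fin 4)) k) (Localization.Away (cobordantAlgebra.subst k (![m + 2, 1, m + 1, 0] : Fin 4 → ℕ) hh * (∏ l : ZMod p, (X (some 1) + (l.val : (MvPolynomial (Option (Fin 4)) k)) * (X (some 0) * X none ^ (m + 1)))) ^ n₁))) (X none * X (some 1) + C (cs j))) := fun j hj => by
    refine hunit_of_dvd _ (Dvd.dvd.mul_right ?_ _)
    rw [hsubst_hh]
    refine dvd_trans ?_ (Finset.dvd_prod_of_mem _ hj)
    have h := Finset.dvd_prod_of_mem (fun l : ZMod p => (X none * X (some 1) + C (cs j) + (l.val : (MvPolynomial (Option (Fin 4)) k)) * (X none ^ (m + 2) * X (some 0)))) (Finset.mem_univ (0 : ZMod p))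
    rwa [ZMod.val_zero, Nat.cast_zero, zero_mul, add_zero] at h
  have hGq' : rename (![none, some 1] : Fin 2 → Option (Fin 4)) (pderiv 1 (X 1 ^ (m + 1) * Polynomial.aeval (X 0 * X 1 : MvPolynomial (Fin 2) k) wl : MvPolynomial (Fin 2) k)) = X (some 1) ^ m * (C c₀ * ∏ j ∈ s, (X none * X (some 1) + C (cs j)) ^ mm j) := by
    rw [GraphTail.pderiv_one_Gq m wl, hwl, map_mul, map_pow, rename_X, ← Polynomial.aeval_algHom_apply, map_mul (rename (![none, some 1] : Fin 2 → Option (Fin 4))), rename_X, rename_X,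
      map_mul, Polynomial.aeval_C, map_prod]
    simp only [map_pow, map_add, Polynomial.aeval_X, Polynomial.aeval_C, MvPolynomial.algebraMap_eq]
    rfl
  have hGu : IsUnit ((algebraMap (MvPolynomial (Option (Fin 4)) k) (Localization.Away (cobordantAlgebra.subst k (![m + 2, 1, m + 1, 0] : Fin 4 → ℕ) hh * (∏ l : ZMod p, (X (some 1) + (l.val : (MvPolynomial (Option (Fin 4)) k)) * (X (some 0) * X none ^ (m + 1)))) ^ n₁))) (rename (![none, some 1] : Fin 2 → Option (Fin 4)) (pderiv 1 (X 1 ^ (m + 1) * Polynomial.aeval (X 0 * X 1 : MvPolynomial (Fin 2) k) wl : MvPolynomial (Fin 2) k)))) := by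
    rw [hGq', map_mul, map_pow, map_mul, map_prod]
    refine (hX1unit.pow m).mul (IsUnit.mul ?_ (IsUnit.prod_iff.mpr fun j hj => ?_))
    · rw [← MvPolynomial.algebraMap_eq, ← IsScalarTower.algebraMap_apply]
      exact (isUnit_iff_ne_zero.mpr hc₀).map _
    · rw [map_pow]; exact (hfacunit j hj).pow _
  -- ### rows of `τ′ = conj Φ σ_chart`; `τ′` fixes `q`
  obtain ⟨rn, r0', -, -⟩ := KillCert.QhAway.qhc_rows_fixed σ hC h0 h1 h2 (X 2 - X 1 ^ (m + 1) * Polynomial.aeval (X 1 : MvPolynomial (Fin 4) k) wl : MvPolynomial (Fin 4) k) h3 (![m + 2, 1, m + 1] : Fin 3 → ℕ) hh hσh hp hσpL hσJ mo 𝒜 y hy hσy Φ hΦa hΦs hΦu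
  have r1' := KillCert.QhAway.qhc_row_one σ h0 h1 h2 (X 2 - X 1 ^ (m + 1) * Polynomial.aeval (X 1 : MvPolynomial (Fin 4) k) wl : MvPolynomial (Fin 4) k) h3 (![m + 2, 1, m + 1] : Fin 3 → ℕ) (m + 1) hw0 hh hσh hp hσpL hσJ mo 𝒜 y hy hσy Φ hΦs hΦu
  have hZPfix : conj Φ (sigmaChart 𝒜 (fun i => algebraMap (MvPolynomial (Fin 4) k) (Localization.Away hh) (X ((![0, 1, 2] : Fin 3 → Fin 4) i))) (![m + 2, 1, m + 1] : Fin 3 → ℕ) dbar y hy (sigmaAway σ hσh) hσJ hp hσpL hσy) ((algebraMap (MvPolynomial (Option (Fin 4)) k) (Localization.Away (cobordantAlgebra.subst k (![m + 2, 1, m + 1, 0] : Fin 4 → ℕ) hh * (∏ l : ZMod p, (X (some 1) + (l.val : (MvPolynomial (Option (Fin 4)) k)) * (X (some 0) * X none ^ (m + 1)))) ^ n₁))) ((∏ l : ZMod p, (X (some 1) + (l.val : (MvPolynomial (Option (Fin 4)) k)) * (X (some 0) * X none ^ (m + 1)))) ^ n₁)) = (algebraMap (MvPolynomial (Option (Fin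 4)) k) (Localization.Away (cobordantAlgebra.subst k (![m + 2, 1, m + 1, 0] : Fin 4 → ℕ) hh * (∏ l : ZMod p, (X (some 1) + (l.val : (MvPolynomial (Option (Fin 4)) k)) * (X (some 0) * X none ^ (m + 1)))) ^ n₁))) ((∏ l : ZMod p, (X (some 1) + (l.val : (MvPolynomial (Option (Fin 4)) k)) * (X (some 0) * X none ^ (m + 1)))) ^ n₁) := by
    have h := QhAbs.qha_norm_one_fixed (p := p) (conj Φ (sigmaChart 𝒜 (fun i => algebraMap (MvPolynomial (Fin 4) k) (Localization.Away hh) (X ((![0, 1, 2] : Fin 3 → Fin 4) i))) (![m + 2, 1, m + 1] : Fin 3 → ℕ) dbar y hy (sigmaAway σ hσh) hσJ hp hσpL hσy)) (![(algebraMap (MvPolynomial (Option (Fin 4)) k) (Localization.Away (cobordantAlgebra.subst k (![m + 2, 1, m + 1, 0] : Fin 4 → ℕ) hh * (∏ l : ZMod p, (X (some 1) + (l.val : (MvPolynomial (Option (Fin 4)) k)) * (X (some 0) * X none ^ (m + 1)))) ^ n₁))) (X none) ^ (m + 1) * (algebraMap (MvPolynomial (Option (Fin 4)) k) (Localization.Away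 (cobordantAlgebra.subst k (![m + 2, 1, m + 1, 0] : Fin 4 → ℕ) hh * (∏ l : ZMod p, (X (some 1) + (l.val : (MvPolynomial (Option (Fin 4)) k)) * (X (some 0) * X none ^ (m + 1)))) ^ n₁))) (X (some 0)), (algebraMap (MvPolynomial (Option (Fin 4)) k) (Localization.Away (cobordantAlgebra.subst k (![m + 2, 1, m + 1, 0] : Fin 4 → ℕ) hh * (∏ l : ZMod p, (X (some 1) + (l.val : (MvPolynomial (Option (Fin 4)) k)) * (X (some 0) * X none ^ (m + 1)))) ^ n₁))) (X (some 1)), 0] : Fin 3 → (Localization.Away (cobordantAlgebra.subst k (![m + 2, 1, m + 1, 0] : Fin 4 → ℕ) hh * (∏ l : ZMod p, (X (some 1) + (l.val : (MvPolynomial (Option (Fin 4)) k)) * (X (some 0) * X none ^ (m + 1)))) ^ n₁)))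
      (by change conj Φ (sigmaChart 𝒜 (fun i => algebraMap (MvPolynomial (Fin 4) k) (Localization.Away hh) (X ((![0, 1, 2] : Fin 3 → Fin 4) i))) (![m + 2, 1, m + 1] : Fin 3 → ℕ) dbar y hy (sigmaAway σ hσh) hσJ hp hσpL hσy) ((algebraMap (MvPolynomial (Option (Fin 4)) k) (Localization.Away (cobordantAlgebra.subst k (![m + 2, 1, m + 1, 0] : Fin 4 → ℕ) hh * (∏ l : ZMod p, (X (some 1) + (l.val : (MvPolynomial (Option (Fin 4)) k)) * (X (some 0) * X none ^ (m + 1)))) ^ n₁))) (X none) ^ (m + 1) * (algebraMap (MvPolynomial (Option (Fin 4)) k) (Localization.Away (cobordantAlgebra.subst k (![m + 2, 1, m + 1, 0] : Fin 4 → ℕ) hh * (∏ l : ZMod p, (X (some 1) + (l.val : (MvPolynomial (Option (Fin 4)) k)) * (X (some 0) * X none ^ (m + 1)))) ^ n₁))) (X (some 0))) = (algebraMap (MvPolynomial (Option (Fin 4)) k) (Localization.Away (cobordantAlgebra.subst k (![m + 2, 1, m + 1, 0] : Fin 4 → ℕ) hh * (∏ l : ZMod p, (X (some 1) + (l.val :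 (MvPolynomial (Option (Fin 4)) k)) * (X (some 0) * X none ^ (m + 1)))) ^ n₁))) (X none) ^ (m + 1) * (algebraMap (MvPolynomial (Option (Fin 4)) k) (Localization.Away (cobordantAlgebra.subst k (![m + 2, 1, m + 1, 0] : Fin 4 → ℕ) hh * (∏ l : ZMod p, (X (some 1) + (l.val : (MvPolynomial (Option (Fin 4)) k)) * (X (some 0) * X none ^ (m + 1)))) ^ n₁))) (X (some 0)); rw [map_mul, map_pow, rn, r0'])
      (by change conj Φ (sigmaChart 𝒜 (fun i => algebraMap (MvPolynomial (Fin 4) k) (Localization.Away hh) (X ((![0, 1, 2] : Fin 3 → Fin 4) i))) (![m + 2, 1, m + 1] : Fin 3 → ℕ) dbar y hy (sigmaAway σ hσh) hσJ hp hσpL hσy) ((algebraMap (MvPolynomial (Option (Fin 4)) k) (Localization.Away (cobordantAlgebra.subst k (![m + 2, 1, m + 1, 0] : Fin 4 → ℕ) hh * (∏ l : ZMod p, (X (some 1) + (l.val : (MvPolynomial (Option (Fin 4)) k)) * (X (some 0) * X none ^ (m + 1)))) ^ n₁))) (X (some 1))) = (algebraMap (MvPolynomial (Option (Fin 4)) k)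 (Localization.Away (cobordantAlgebra.subst k (![m + 2, 1, m + 1, 0] : Fin 4 → ℕ) hh * (∏ l : ZMod p, (X (some 1) + (l.val : (MvPolynomial (Option (Fin 4)) k)) * (X (some 0) * X none ^ (m + 1)))) ^ n₁))) (X (some 1)) + (algebraMap (MvPolynomial (Option (Fin 4)) k) (Localization.Away (cobordantAlgebra.subst k (![m + 2, 1, m + 1, 0] : Fin 4 → ℕ) hh * (∏ l : ZMod p, (X (some 1) + (l.val : (MvPolynomial (Option (Fin 4)) k)) * (X (some 0) * X none ^ (m + 1)))) ^ n₁))) (X none) ^ (m + 1) * (algebraMap (MvPolynomial (Option (Fin 4)) k) (Localization.Away (cobordantAlgebra.subst k (![m + 2, 1, m + 1, 0] : Fin 4 → ℕ) hh * (∏ l : ZMod p, (X (some 1) + (l.val : (MvPolynomial (Option (Fin 4)) k)) * (X (some 0) * X none ^ (m + 1)))) ^ n₁))) (X (some 0)); exact r1') hp1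
    have hZPeq : (algebraMap (MvPolynomial (Option (Fin 4)) k) (Localization.Away (cobordantAlgebra.subst k (![m + 2, 1, m + 1, 0] : Fin 4 → ℕ) hh * (∏ l : ZMod p, (X (some 1) + (l.val : (MvPolynomial (Option (Fin 4)) k)) * (X (some 0) * X none ^ (m + 1)))) ^ n₁))) ((∏ l : ZMod p, (X (some 1) + (l.val : (MvPolynomial (Option (Fin 4)) k)) * (X (some 0) * X none ^ (m + 1)))) ^ n₁) = (∏ i : ZMod p, ((![(algebraMap (MvPolynomial (Option (Fin 4)) k) (Localization.Away (cobordantAlgebra.subst k (![m + 2, 1, m + 1, 0] : Fin 4 → ℕ) hh * (∏ l : ZMod p, (X (some 1) + (l.val : (MvPolynomial (Option (Fin 4)) k)) * (X (some 0) * X none ^ (m + 1)))) ^ n₁))) (X none) ^ (m + 1) * (algebraMap (MvPolynomial (Option (Fin 4)) k) (Localization.Away (cobordantAlgebra.subst k (![m + 2, 1, m + 1, 0] : Fin 4 → ℕ) hh * (∏ l : ZMod p, (X (some 1) + (l.val : (MvPolynomial (Option (Fin 4)) k)) * (X (some 0) * X none ^ (m + 1)))) ^ n₁))) (X (some 0)),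 (algebraMap (MvPolynomial (Option (Fin 4)) k) (Localization.Away (cobordantAlgebra.subst k (![m + 2, 1, m + 1, 0] : Fin 4 → ℕ) hh * (∏ l : ZMod p, (X (some 1) + (l.val : (MvPolynomial (Option (Fin 4)) k)) * (X (some 0) * X none ^ (m + 1)))) ^ n₁))) (X (some 1)), 0] : Fin 3 → (Localization.Away (cobordantAlgebra.subst k (![m + 2, 1, m + 1, 0] : Fin 4 → ℕ) hh * (∏ l : ZMod p, (X (some 1) + (l.val : (MvPolynomial (Option (Fin 4)) k)) * (X (some 0) * X none ^ (m + 1)))) ^ n₁))) 1 +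
        (i.val : (Localization.Away (cobordantAlgebra.subst k (![m + 2, 1, m + 1, 0] : Fin 4 → ℕ) hh * (∏ l : ZMod p, (X (some 1) + (l.val : (MvPolynomial (Option (Fin 4)) k)) * (X (some 0) * X none ^ (m + 1)))) ^ n₁))) * (![(algebraMap (MvPolynomial (Option (Fin 4)) k) (Localization.Away (cobordantAlgebra.subst k (![m + 2, 1, m + 1, 0] : Fin 4 → ℕ) hh * (∏ l : ZMod p, (X (some 1) + (l.val : (MvPolynomial (Option (Fin 4)) k)) * (X (some 0) * X none ^ (m + 1)))) ^ n₁))) (X none) ^ (m + 1) * (algebraMap (MvPolynomial (Option (Fin 4)) k) (Localization.Away (cobordantAlgebra.subst k (![m + 2, 1, m + 1, 0] : Fin 4 → ℕ) hh * (∏ l : ZMod p, (X (some 1) + (l.val : (MvPolynomial (Option (Fin 4)) k)) * (X (some 0) * X none ^ (m + 1)))) ^ n₁))) (X (some 0)), (algebraMap (MvPolynomial (Option (Fin 4)) k) (Localization.Away (cobordantAlgebra.subst k (![m + 2, 1, m + 1, 0] : Fin 4 → ℕ) hh * (∏ l : ZMod p, (X (some 1) + (l.val : (MvPolynomial (Option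 (Fin 4)) k)) * (X (some 0) * X none ^ (m + 1)))) ^ n₁))) (X (some 1)), 0] : Fin 3 → (Localization.Away (cobordantAlgebra.subst k (![m + 2, 1, m + 1, 0] : Fin 4 → ℕ) hh * (∏ l : ZMod p, (X (some 1) + (l.val : (MvPolynomial (Option (Fin 4)) k)) * (X (some 0) * X none ^ (m + 1)))) ^ n₁))) 0)) ^ n₁ := by
      rw [map_pow, map_prod]
      refine congrArg (· ^ n₁) (Finset.prod_congr rfl fun l _ => ?_)
      rw [map_add, map_mul, map_natCast, map_mul, map_pow]
      change _ = (algebraMap (MvPolynomial (Option (Fin 4)) k) (Localization.Away (cobordantAlgebra.subst k (![m + 2, 1, m + 1, 0] : Fin 4 → ℕ) hh * (∏ l : ZMod p, (X (some 1) + (l.val : (MvPolynomial (Option (Fin 4)) k)) * (X (some 0) * X none ^ (m + 1)))) ^ n₁))) (X (some 1)) + _ * ((algebraMap (MvPolynomial (Option (Fin 4)) k) (Localization.Away (cobordantAlgebra.subst k (![m + 2, 1, m + 1, 0] : Fin 4 → ℕ) hh * (∏ l : ZMod p, (X (some 1) + (l.val : (MvPolynomial (Option (Fin 4)) k)) * (X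 (some 0) * X none ^ (m + 1)))) ^ n₁))) (X none) ^ (m + 1) * (algebraMap (MvPolynomial (Option (Fin 4)) k) (Localization.Away (cobordantAlgebra.subst k (![m + 2, 1, m + 1, 0] : Fin 4 → ℕ) hh * (∏ l : ZMod p, (X (some 1) + (l.val : (MvPolynomial (Option (Fin 4)) k)) * (X (some 0) * X none ^ (m + 1)))) ^ n₁))) (X (some 0)))
      ring
    rw [hZPeq, map_pow, h]
  have hrs : conj Φ (sigmaChart 𝒜 (fun i => algebraMap (MvPolynomial (Fin 4) k) (Localization.Away hh) (X ((![0, 1, 2] : Fin 3 → Fin 4) i))) (![m + 2, 1, m + 1] : Fin 3 → ℕ) dbar y hy (sigmaAway σ hσh) hσJ hp hσpL hσy) ((algebraMap (MvPolynomial (Option (Fin 4)) k) (Localization.Away (cobordantAlgebra.subst k (![m + 2, 1, m + 1, 0] : Fin 4 → ℕ) hh * (∏ l : ZMod p, (X (some 1) + (l.val : (MvPolynomial (Option (Fin 4)) k)) * (X (some 0) * X none ^ (m + 1)))) ^ n₁))) (cobordantAlgebra.subst k (![m + 2, 1, m + 1, 0] : Fin 4 → ℕ) hh)) = (algebraMap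 (MvPolynomial (Option (Fin 4)) k) (Localization.Away (cobordantAlgebra.subst k (![m + 2, 1, m + 1, 0] : Fin 4 → ℕ) hh * (∏ l : ZMod p, (X (some 1) + (l.val : (MvPolynomial (Option (Fin 4)) k)) * (X (some 0) * X none ^ (m + 1)))) ^ n₁))) (cobordantAlgebra.subst k (![m + 2, 1, m + 1, 0] : Fin 4 → ℕ) hh) :=
    KillCert.QhAway.qhc_row_subst σ (![m + 2, 1, m + 1] : Fin 3 → ℕ) hh hσh hp hσpL hσJ mo 𝒜 y hy hσy Φ hΦa hh hσh
  have hτq : conj Φ (sigmaChart 𝒜 (fun i => algebraMap (MvPolynomial (Fin 4) k) (Localization.Away hh) (X ((![0, 1, 2] : Fin 3 → Fin 4) i))) (![m + 2, 1, m + 1] : Fin 3 → ℕ) dbar y hy (sigmaAway σ hσh) hσJ hp hσpL hσy) ((algebraMap (MvPolynomial (Option (Fin 4)) k) (Localization.Away (cobordantAlgebra.subst k (![m + 2, 1, m + 1, 0] : Fin 4 → ℕ) hh * (∏ l : ZMod p, (X (some 1) + (l.val : (MvPolynomial (Option (Fin 4)) k)) * (X (some 0) * X none ^ (m + 1)))) ^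 n₁))) (cobordantAlgebra.subst k (![m + 2, 1, m + 1, 0] : Fin 4 → ℕ) hh * (∏ l : ZMod p, (X (some 1) + (l.val : (MvPolynomial (Option (Fin 4)) k)) * (X (some 0) * X none ^ (m + 1)))) ^ n₁)) = (algebraMap (MvPolynomial (Option (Fin 4)) k) (Localization.Away (cobordantAlgebra.subst k (![m + 2, 1, m + 1, 0] : Fin 4 → ℕ) hh * (∏ l : ZMod p, (X (some 1) + (l.val : (MvPolynomial (Option (Fin 4)) k)) * (X (some 0) * X none ^ (m + 1)))) ^ n₁))) (cobordantAlgebra.subst k (![m + 2, 1, m + 1, 0] : Fin 4 → ℕ) hh * (∏ l : ZMod p, (X (some 1) + (l.val : (MvPolynomial (Option (Fin 4)) k)) * (X (some 0) * X none ^ (m + 1)))) ^ n₁) := by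
    rw [map_mul, map_mul, hrs, hZPfix]
  -- ### the local tail: subst pin, model pin, degrees
  have hT' := GraphTail.subst_graphTail (k := k) m wl
  have hφeq := KillCert.QhAway.qhc_tail_eq (X 2 - X 1 ^ (m + 1) * Polynomial.aeval (X 1 : MvPolynomial (Fin 4) k) wl : MvPolynomial (Fin 4) k) (![m + 2, 1, m + 1] : Fin 3 → ℕ) (m + 1) hh mo 𝒜 y hy hq0 Φ hΦa hΦs ht (X (some 2) - rename (![none, some 1] : Fin 2 → Option (Fin 4)) (X 1 ^ (m + 1) * Polynomial.aeval (X 0 * X 1 : MvPolynomial (Fin 2) k) wl : MvPolynomial (Fin 2) k)) hT'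
  have hφd : (algebraMap (MvPolynomial (Option (Fin 4)) k) (Localization.Away (cobordantAlgebra.subst k (![m + 2, 1, m + 1, 0] : Fin 4 → ℕ) hh * (∏ l : ZMod p, (X (some 1) + (l.val : (MvPolynomial (Option (Fin 4)) k)) * (X (some 0) * X none ^ (m + 1)))) ^ n₁))) (X (some 2) - rename (![none, some 1] : Fin 2 → Option (Fin 4)) (X 1 ^ (m + 1) * Polynomial.aeval (X 0 * X 1 : MvPolynomial (Fin 2) k) wl : MvPolynomial (Fin 2) k)) ∈ mapGrading (chartNodeGrading mo 𝒜 (fun i => algebraMap (MvPolynomial (Fin 4) k) (Localization.Away hh) (X ((![0, 1, 2] : Fin 3 → Fin 4) i))) (![m + 2, 1, m + 1] : Fin 3 → ℕ) hf dbar y hy) Φ ((m + 1) • (consIndexEquiv mo ((1 : ℤ), (0 : Π j : Fin mg, ZMod (mo j))))) := by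
    rw [← hφeq]; exact KillCert.QhAway.qhc_degree_tail (X 2 - X 1 ^ (m + 1) * Polynomial.aeval (X 1 : MvPolynomial (Fin 4) k) wl : MvPolynomial (Fin 4) k) (![m + 2, 1, m + 1] : Fin 3 → ℕ) (m + 1) hh mo 𝒜 hf y hy Φ ht ht0A
  have hX0d : (algebraMap (MvPolynomial (Option (Fin 4)) k) (Localization.Away (cobordantAlgebra.subst k (![m + 2, 1, m + 1, 0] : Fin 4 → ℕ) hh * (∏ l : ZMod p, (X (some 1) + (l.val : (MvPolynomial (Option (Fin 4)) k)) * (X (some 0) * X none ^ (m + 1)))) ^ n₁))) (X (some 0)) ∈ mapGrading (chartNodeGrading mo 𝒜 (fun i => algebraMap (MvPolynomial (Fin 4) k) (Localization.Away hh) (X ((![0, 1, 2] : Fin 3 → Fin 4) i))) (![m + 2, 1, m + 1] : Fin 3 → ℕ) hf dbar y hy) Φ ((m + 2) • (consIndexEquiv mo ((1 : ℤ), (0 : Π j : Fin mg, ZMod (mo j))))) := KillCert.QhAway.qhc_degree_u' (![m + 2, 1, m + 1] : Fin 3 → ℕ) hh mo 𝒜 hf y hy Φ hΦu 0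
  have hX1d : (algebraMap (MvPolynomial (Option (Fin 4)) k) (Localization.Away (cobordantAlgebra.subst k (![m + 2, 1, m + 1, 0] : Fin 4 → ℕ) hh * (∏ l : ZMod p, (X (some 1) + (l.val : (MvPolynomial (Option (Fin 4)) k)) * (X (some 0) * X none ^ (m + 1)))) ^ n₁))) (X (some 1)) ∈ mapGrading (chartNodeGrading mo 𝒜 (fun i => algebraMap (MvPolynomial (Fin 4) k) (Localization.Away hh) (X ((![0, 1, 2] : Fin 3 → Fin 4) i))) (![m + 2, 1, m + 1] : Fin 3 → ℕ) hf dbar y hy) Φ ((1 : ℕ) • (consIndexEquiv mo ((1 : ℤ), (0 : Π j : Fin mg, ZMod (mo j))))) := KillCert.QhAway.qhc_degree_u' (![m + 2, 1, m + 1] : Fin 3 → ℕ) hh mo 𝒜 hf y hy Φ hΦu 1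
  -- the `k`-point off `q = 0`
  have hu' : MvPolynomial.eval (fun o : Option (Fin 4) => o.elim (0 : k) ![0, 1, MvPolynomial.eval ![0, 1] (X 1 ^ (m + 1) * Polynomial.aeval (X 0 * X 1 : MvPolynomial (Fin 2) k) wl : MvPolynomial (Fin 2) k), 0]) (cobordantAlgebra.subst k (![m + 2, 1, m + 1, 0] : Fin 4 → ℕ) hh * (∏ l : ZMod p, (X (some 1) + (l.val : (MvPolynomial (Option (Fin 4)) k)) * (X (some 0) * X none ^ (m + 1)))) ^ n₁) ≠ 0 := hu
  -- ### the Veronese degree of the member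
  obtain ⟨d₀, hver⟩ := KillCert.QhAway.exists_veroneseNormalised_graphChartAway σ (![m + 2, 1, m + 1] : Fin 3 → ℕ) (m + 1) hh hσh hp hσpL hσJ mo 𝒜 hf y hy hσy Φ hΦu htame
    ((algebraMap (MvPolynomial (Option (Fin 4)) k) (Localization.Away (cobordantAlgebra.subst k (![m + 2, 1, m + 1, 0] : Fin 4 → ℕ) hh * (∏ l : ZMod p, (X (some 1) + (l.val : (MvPolynomial (Option (Fin 4)) k)) * (X (some 0) * X none ^ (m + 1)))) ^ n₁))) (X (some 2) - rename (![none, some 1] : Fin 2 → Option (Fin 4)) (X 1 ^ (m + 1) * Polynomial.aeval (X 0 * X 1 : MvPolynomial (Fin 2) k) wl : MvPolynomial (Fin 2) k))) hφd ![2, 1]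
  -- ### degree-0 associates of the member generators, and the sections `a`, `b`
  obtain ⟨ι₀, hι₀d, hι₀, hι₀u⟩ := CoarseChart.exists_inv_pow_mem_of_isUnit (mapGrading (chartNodeGrading mo 𝒜 (fun i => algebraMap (MvPolynomial (Fin 4) k) (Localization.Away hh) (X ((![0, 1, 2] : Fin 3 → Fin 4) i))) (![m + 2, 1, m + 1] : Fin 3 → ℕ) hf dbar y hy) Φ) hX1d hX1unit (m + 2)
  obtain ⟨ι₁, hι₁d, hι₁, hι₁u⟩ := CoarseChart.exists_inv_pow_mem_of_isUnit (mapGrading (chartNodeGrading mo 𝒜 (fun i => algebraMap (MvPolynomial (Fin 4) k) (Localization.Away hh) (X ((![0, 1, 2] : Fin 3 → Fin 4) i))) (![m + 2, 1, m + 1] : Fin 3 → ℕ) hf dbar y hy) Φ) hX1d hX1unit (m + 1)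
  have ha0 : (algebraMap (MvPolynomial (Option (Fin 4)) k) (Localization.Away (cobordantAlgebra.subst k (![m + 2, 1, m + 1, 0] : Fin 4 → ℕ) hh * (∏ l : ZMod p, (X (some 1) + (l.val : (MvPolynomial (Option (Fin 4)) k)) * (X (some 0) * X none ^ (m + 1)))) ^ n₁))) (X (some 0)) * ι₀ ∈ mapGrading (chartNodeGrading mo 𝒜 (fun i => algebraMap (MvPolynomial (Fin 4) k) (Localization.Away hh) (X ((![0, 1, 2] : Fin 3 → Fin 4) i))) (![m + 2, 1, m + 1] : Fin 3 → ℕ) hf dbar y hy) Φ 0 := by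
    have h := SetLike.mul_mem_graded hX0d hι₀d
    rwa [one_nsmul, add_neg_cancel] at h
  have hb0 : (algebraMap (MvPolynomial (Option (Fin 4)) k) (Localization.Away (cobordantAlgebra.subst k (![m + 2, 1, m + 1, 0] : Fin 4 → ℕ) hh * (∏ l : ZMod p, (X (some 1) + (l.val : (MvPolynomial (Option (Fin 4)) k)) * (X (some 0) * X none ^ (m + 1)))) ^ n₁))) (X (some 2) - rename (![none, some 1] : Fin 2 → Option (Fin 4)) (X 1 ^ (m + 1) * Polynomial.aeval (X 0 * X 1 : MvPolynomial (Fin 2) k) wl : MvPolynomial (Fin 2) k)) * ι₁ ∈ mapGrading (chartNodeGrading mo 𝒜 (fun i => algebraMap (MvPolynomial (Fin 4) k) (Localization.Away hh) (X ((![0, 1, 2] : Fin 3 → Fin 4) i))) (![m + 2, 1, m + 1] : Fin 3 → ℕ) hf dbar y hy) Φ 0 := by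
    have h := SetLike.mul_mem_graded hφd hι₁d
    rwa [one_nsmul, add_neg_cancel] at h
  obtain ⟨eL, heL⟩ : ∃ eL : Γ(M.V, W.1) ≃+* ↥(mapGrading (chartNodeGrading mo 𝒜 (fun i => algebraMap (MvPolynomial (Fin 4) k) (Localization.Away hh) (X ((![0, 1, 2] : Fin 3 → Fin 4) i))) (![m + 2, 1, m + 1] : Fin 3 → ℕ) hf dbar y hy) Φ 0), eL = E.trans (zeroRingEquiv (chartNodeGrading mo 𝒜 (fun i => algebraMap (MvPolynomial (Fin 4) k) (Localization.Away hh) (X ((![0, 1, 2] : Fin 3 → Fin 4) i))) (![m + 2, 1, m + 1] : Fin 3 → ℕ) hf dbar y hy) Φ) := ⟨_, rfl⟩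
  have heLval : ∀ x : Γ(M.V, W.1), ((eL x : ↥(mapGrading (chartNodeGrading mo 𝒜 (fun i => algebraMap (MvPolynomial (Fin 4) k) (Localization.Away hh) (X ((![0, 1, 2] : Fin 3 → Fin 4) i))) (![m + 2, 1, m + 1] : Fin 3 → ℕ) hf dbar y hy) Φ 0)) : (Localization.Away (cobordantAlgebra.subst k (![m + 2, 1, m + 1, 0] : Fin 4 → ℕ) hh * (∏ l : ZMod p, (X (some 1) + (l.val : (MvPolynomial (Option (Fin 4)) k)) * (X (some 0) * X none ^ (m + 1)))) ^ n₁))) = Φ ((E x : ↥((chartNodeGrading mo 𝒜 (fun i => algebraMap (MvPolynomial (Fin 4) k) (Localization.Away hh) (X ((![0, 1, 2] : Fin 3 → Fin 4) i))) (![m + 2, 1, m + 1] : Fin 3 → ℕ) hf dbar y hy) 0)) : (ChartRing 𝒜 (fun i => algebraMap (MvPolynomial (Fin 4) k) (Localization.Away hh) (X ((![0, 1, 2] : Fin 3 → Fin 4) i))) (![m + 2, 1, m + 1] : Fin 3 → ℕ) dbar y hy)) := fun _ => by rw [heL]; rfl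
  obtain ⟨a, ha⟩ : ∃ a : Γ(M.V, W.1), a = eL.symm ⟨_, ha0⟩ := ⟨_, rfl⟩
  obtain ⟨b, hb⟩ : ∃ b : Γ(M.V, W.1), b = eL.symm ⟨_, hb0⟩ := ⟨_, rfl⟩
  have hea : ((eL a : ↥(mapGrading (chartNodeGrading mo 𝒜 (fun i => algebraMap (MvPolynomial (Fin 4) k) (Localization.Away hh) (X ((![0, 1, 2] : Fin 3 → Fin 4) i))) (![m + 2, 1, m + 1] : Fin 3 → ℕ) hf dbar y hy) Φ 0)) : (Localization.Away (cobordantAlgebra.subst k (![m + 2, 1, m + 1, 0] : Fin 4 → ℕ) hh * (∏ l : ZMod p, (X (some 1) + (l.val : (MvPolynomial (Option (Fin 4)) k)) * (X (some 0) * X none ^ (m + 1)))) ^ n₁))) = (algebraMap (MvPolynomial (Option (Fin 4)) k) (Localization.Away (cobordantAlgebra.subst k (![m + 2, 1, m + 1, 0] : Fin 4 → ℕ) hh * (∏ l : ZMod p, (X (some 1) + (l.val : (MvPolynomial (Option (Fin 4)) k)) * (X (some 0) * X none ^ (m + 1)))) ^ n₁))) (X (some 0)) * ι₀ := by rw [ha,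 eL.apply_symm_apply]
  have heb : ((eL b : ↥(mapGrading (chartNodeGrading mo 𝒜 (fun i => algebraMap (MvPolynomial (Fin 4) k) (Localization.Away hh) (X ((![0, 1, 2] : Fin 3 → Fin 4) i))) (![m + 2, 1, m + 1] : Fin 3 → ℕ) hf dbar y hy) Φ 0)) : (Localization.Away (cobordantAlgebra.subst k (![m + 2, 1, m + 1, 0] : Fin 4 → ℕ) hh * (∏ l : ZMod p, (X (some 1) + (l.val : (MvPolynomial (Option (Fin 4)) k)) * (X (some 0) * X none ^ (m + 1)))) ^ n₁))) = (algebraMap (MvPolynomial (Option (Fin 4)) k) (Localization.Away (cobordantAlgebra.subst k (![m + 2, 1, m + 1, 0] : Fin 4 → ℕ) hh * (∏ l : ZMod p, (X (some 1) + (l.val : (MvPolynomial (Option (Fin 4)) k)) * (X (some 0) * X none ^ (m + 1)))) ^ n₁))) (X (some 2) - rename (![none, some 1] : Fin 2 → Option (Fin 4)) (X 1 ^ (m + 1) * Polynomial.aeval (X 0 * X 1 : MvPolynomial (Fin 2) k) wl : MvPolynomial (Fin 2) k)) * ι₁ := by rw [hb, eL.apply_symm_apply]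
  -- values of the given sections
  have her0 : ((eL r0 : ↥(mapGrading (chartNodeGrading mo 𝒜 (fun i => algebraMap (MvPolynomial (Fin 4) k) (Localization.Away hh) (X ((![0, 1, 2] : Fin 3 → Fin 4) i))) (![m + 2, 1, m + 1] : Fin 3 → ℕ) hf dbar y hy) Φ 0)) : (Localization.Away (cobordantAlgebra.subst k (![m + 2, 1, m + 1, 0] : Fin 4 → ℕ) hh * (∏ l : ZMod p, (X (some 1) + (l.val : (MvPolynomial (Option (Fin 4)) k)) * (X (some 0) * X none ^ (m + 1)))) ^ n₁))) = (algebraMap (MvPolynomial (Option (Fin 4)) k) (Localization.Away (cobordantAlgebra.subst k (![m + 2, 1, m + 1, 0] : Fin 4 → ℕ) hh * (∏ l : ZMod p, (X (some 1) + (l.val : (MvPolynomial (Option (Fin 4)) k)) * (X (some 0) * X none ^ (m + 1)))) ^ n₁))) (X none) ^ (m + 2) * (algebraMap (MvPolynomial (Option (Fin 4)) k) (Localization.Away (cobordantAlgebra.subst k (![m + 2, 1, m + 1, 0] : Fin 4 → ℕ) hh * (∏ l : ZMod p, (X (some 1) + (l.val : (MvPolynomial (Option (Fin 4)) k)) * (X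 (some 0) * X none ^ (m + 1)))) ^ n₁))) (X (some 0)) := by
    rw [heLval, hr0]
    refine (hΦa (X 0)).trans ?_
    rw [hsubX, map_mul, map_pow]; rfl
  have her1 : ((eL r1 : ↥(mapGrading (chartNodeGrading mo 𝒜 (fun i => algebraMap (MvPolynomial (Fin 4) k) (Localization.Away hh) (X ((![0, 1, 2] : Fin 3 → Fin 4) i))) (![m + 2, 1, m + 1] : Fin 3 → ℕ) hf dbar y hy) Φ 0)) : (Localization.Away (cobordantAlgebra.subst k (![m + 2, 1, m + 1, 0] : Fin 4 → ℕ) hh * (∏ l : ZMod p, (X (some 1) + (l.val : (MvPolynomial (Option (Fin 4)) k)) * (X (some 0) * X none ^ (m + 1)))) ^ n₁))) = (algebraMap (MvPolynomial (Option (Fin 4)) k) (Localization.Away (cobordantAlgebra.subst k (![m + 2, 1, m + 1, 0] : Fin 4 → ℕ) hh * (∏ l : ZMod p, (X (some 1) + (l.val : (MvPolynomial (Option (Fin 4)) k)) * (X (some 0) * X none ^ (m + 1)))) ^ n₁))) (X none) * (algebraMap (MvPolynomial (Option (Fin 4)) k) (Localization.Away (cobordantAlgebra.subst k (![m + 2,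 1, m + 1, 0] : Fin 4 → ℕ) hh * (∏ l : ZMod p, (X (some 1) + (l.val : (MvPolynomial (Option (Fin 4)) k)) * (X (some 0) * X none ^ (m + 1)))) ^ n₁))) (X (some 1)) := by
    rw [heLval, hr1]
    refine (hΦa (X 1)).trans ?_
    rw [hsubX, map_mul, map_pow]
    change (algebraMap (MvPolynomial (Option (Fin 4)) k) (Localization.Away (cobordantAlgebra.subst k (![m + 2, 1, m + 1, 0] : Fin 4 → ℕ) hh * (∏ l : ZMod p, (X (some 1) + (l.val : (MvPolynomial (Option (Fin 4)) k)) * (X (some 0) * X none ^ (m + 1)))) ^ n₁))) (X none) ^ 1 * _ = _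
    rw [pow_one]
  have hert : ((eL rt : ↥(mapGrading (chartNodeGrading mo 𝒜 (fun i => algebraMap (MvPolynomial (Fin 4) k) (Localization.Away hh) (X ((![0, 1, 2] : Fin 3 → Fin 4) i))) (![m + 2, 1, m + 1] : Fin 3 → ℕ) hf dbar y hy) Φ 0)) : (Localization.Away (cobordantAlgebra.subst k (![m + 2, 1, m + 1, 0] : Fin 4 → ℕ) hh * (∏ l : ZMod p, (X (some 1) + (l.val : (MvPolynomial (Option (Fin 4)) k)) * (X (some 0) * X none ^ (m + 1)))) ^ n₁))) = (algebraMap (MvPolynomial (Option (Fin 4)) k) (Localization.Away (cobordantAlgebra.subst k (![m + 2, 1, m + 1, 0] : Fin 4 → ℕ) hh * (∏ l : ZMod p, (X (some 1) + (l.val : (MvPolynomial (Option (Fin 4)) k)) * (X (some 0) * X none ^ (m + 1)))) ^ n₁))) (X none) ^ (m + 1) * (algebraMap (MvPolynomial (Option (Fin 4)) k) (Localization.Away (cobordantAlgebra.subst k (![m + 2, 1, m + 1, 0] : Fin 4 → ℕ) hh * (∏ l : ZMod p, (X (some 1) + (l.val : (MvPolynomial (Option (Fin 4)) k)) * (X (some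 0) * X none ^ (m + 1)))) ^ n₁))) (X (some 2) - rename (![none, some 1] : Fin 2 → Option (Fin 4)) (X 1 ^ (m + 1) * Polynomial.aeval (X 0 * X 1 : MvPolynomial (Fin 2) k) wl : MvPolynomial (Fin 2) k)) := by
    rw [heLval, hrt, hΦa, hT', map_mul, map_pow]
  -- ### the relations `a·r₁^{m+2} = r₀`, `b·r₁^{m+1} = r_t`
  have hrel_a : a * r1 ^ (m + 2) = r0 := by
    apply eL.injective
    apply Subtype.ext
    rw [map_mul, map_pow, SetLike.GradeZero.coe_mul, SetLike.GradeZero.coe_pow, hea, her1, her0]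
    calc (algebraMap (MvPolynomial (Option (Fin 4)) k) (Localization.Away (cobordantAlgebra.subst k (![m + 2, 1, m + 1, 0] : Fin 4 → ℕ) hh * (∏ l : ZMod p, (X (some 1) + (l.val : (MvPolynomial (Option (Fin 4)) k)) * (X (some 0) * X none ^ (m + 1)))) ^ n₁))) (X (some 0)) * ι₀ * ((algebraMap (MvPolynomial (Option (Fin 4)) k) (Localization.Away (cobordantAlgebra.subst k (![m + 2, 1, m + 1, 0] : Fin 4 → ℕ) hh * (∏ l : ZMod p, (X (some 1) + (l.val : (MvPolynomial (Option (Fin 4)) k)) * (X (some 0) * X none ^ (m + 1)))) ^ n₁))) (X none) * (algebraMap (MvPolynomial (Option (Fin 4)) k) (Localization.Away (cobordantAlgebra.subst k (![m + 2, 1, m + 1, 0] : Fin 4 → ℕ) hh * (∏ l : ZMod p, (X (some 1) + (l.val : (MvPolynomial (Option (Fin 4)) k)) * (X (some 0) * X none ^ (m + 1)))) ^ n₁))) (X (some 1))) ^ (m + 2)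
        = (algebraMap (MvPolynomial (Option (Fin 4)) k) (Localization.Away (cobordantAlgebra.subst k (![m + 2, 1, m + 1, 0] : Fin 4 → ℕ) hh * (∏ l : ZMod p, (X (some 1) + (l.val : (MvPolynomial (Option (Fin 4)) k)) * (X (some 0) * X none ^ (m + 1)))) ^ n₁))) (X none) ^ (m + 2) * (algebraMap (MvPolynomial (Option (Fin 4)) k) (Localization.Away (cobordantAlgebra.subst k (![m + 2, 1, m + 1, 0] : Fin 4 → ℕ) hh * (∏ l : ZMod p, (X (some 1) + (l.val : (MvPolynomial (Option (Fin 4)) k)) * (X (some 0) * X none ^ (m + 1)))) ^ n₁))) (X (some 0)) * ((algebraMap (MvPolynomial (Option (Fin 4)) k) (Localization.Away (cobordantAlgebra.subst k (![m + 2, 1, m + 1, 0] : Fin 4 → ℕ) hh * (∏ l : ZMod p, (X (some 1) + (l.val : (MvPolynomial (Option (Fin 4)) k)) * (X (some 0) * X none ^ (m + 1)))) ^ n₁))) (X (some 1)) ^ (m + 2) * ι₀) := by ring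
      _ = (algebraMap (MvPolynomial (Option (Fin 4)) k) (Localization.Away (cobordantAlgebra.subst k (![m + 2, 1, m + 1, 0] : Fin 4 → ℕ) hh * (∏ l : ZMod p, (X (some 1) + (l.val : (MvPolynomial (Option (Fin 4)) k)) * (X (some 0) * X none ^ (m + 1)))) ^ n₁))) (X none) ^ (m + 2) * (algebraMap (MvPolynomial (Option (Fin 4)) k) (Localization.Away (cobordantAlgebra.subst k (![m + 2, 1, m + 1, 0] : Fin 4 → ℕ) hh * (∏ l : ZMod p, (X (some 1) + (l.val : (MvPolynomial (Option (Fin 4)) k)) * (X (some 0) * X none ^ (m + 1)))) ^ n₁))) (X (some 0)) := by rw [hι₀, mul_one]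
  have hrel_b : b * r1 ^ (m + 1) = rt := by
    apply eL.injective
    apply Subtype.ext
    rw [map_mul, map_pow, SetLike.GradeZero.coe_mul, SetLike.GradeZero.coe_pow, heb, her1, hert]
    calc (algebraMap (MvPolynomial (Option (Fin 4)) k) (Localization.Away (cobordantAlgebra.subst k (![m + 2, 1, m + 1, 0] : Fin 4 → ℕ) hh * (∏ l : ZMod p, (X (some 1) + (l.val : (MvPolynomial (Option (Fin 4)) k)) * (X (some 0) * X none ^ (m + 1)))) ^ n₁))) (X (some 2) - rename (![none, some 1] : Fin 2 → Option (Fin 4)) (X 1 ^ (m + 1) * Polynomial.aeval (X 0 * X 1 : MvPolynomial (Fin 2) k) wl : MvPolynomial (Fin 2) k)) * ι₁ * ((algebraMap (MvPolynomial (Option (Fin 4)) k) (Localization.Away (cobordantAlgebra.subst k (![m + 2, 1, m + 1, 0] : Fin 4 → ℕ) hh * (∏ l : ZMod p, (X (some 1) + (l.val : (MvPolynomial (Option (Fin 4)) k)) * (X (some 0) * X none ^ (m + 1)))) ^ n₁))) (X none) * (algebraMap (MvPolynomial (Option (Fin 4)) k) (Localization.Away (cobordantAlgebra.subst k (![m +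 2, 1, m + 1, 0] : Fin 4 → ℕ) hh * (∏ l : ZMod p, (X (some 1) + (l.val : (MvPolynomial (Option (Fin 4)) k)) * (X (some 0) * X none ^ (m + 1)))) ^ n₁))) (X (some 1))) ^ (m + 1)
        = (algebraMap (MvPolynomial (Option (Fin 4)) k) (Localization.Away (cobordantAlgebra.subst k (![m + 2, 1, m + 1, 0] : Fin 4 → ℕ) hh * (∏ l : ZMod p, (X (some 1) + (l.val : (MvPolynomial (Option (Fin 4)) k)) * (X (some 0) * X none ^ (m + 1)))) ^ n₁))) (X none) ^ (m + 1) * (algebraMap (MvPolynomial (Option (Fin 4)) k) (Localization.Away (cobordantAlgebra.subst k (![m + 2, 1, m + 1, 0] : Fin 4 → ℕ) hh * (∏ l : ZMod p, (X (some 1) + (l.val : (MvPolynomial (Option (Fin 4)) k)) * (X (some 0) * X none ^ (m + 1)))) ^ n₁))) (X (some 2) - rename (![none, some 1] : Fin 2 → Option (Fin 4)) (X 1 ^ (m + 1) * Polynomial.aeval (X 0 * X 1 : MvPolynomial (Fin 2) k) wl : MvPolynomial (Fin 2) k)) * ((algebraMap (MvPolynomial (Option (Fin 4)) k) (Localization.Away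 (cobordantAlgebra.subst k (![m + 2, 1, m + 1, 0] : Fin 4 → ℕ) hh * (∏ l : ZMod p, (X (some 1) + (l.val : (MvPolynomial (Option (Fin 4)) k)) * (X (some 0) * X none ^ (m + 1)))) ^ n₁))) (X (some 1)) ^ (m + 1) * ι₁) := by ring
      _ = (algebraMap (MvPolynomial (Option (Fin 4)) k) (Localization.Away (cobordantAlgebra.subst k (![m + 2, 1, m + 1, 0] : Fin 4 → ℕ) hh * (∏ l : ZMod p, (X (some 1) + (l.val : (MvPolynomial (Option (Fin 4)) k)) * (X (some 0) * X none ^ (m + 1)))) ^ n₁))) (X none) ^ (m + 1) * (algebraMap (MvPolynomial (Option (Fin 4)) k) (Localization.Away (cobordantAlgebra.subst k (![m + 2, 1, m + 1, 0] : Fin 4 → ℕ) hh * (∏ l : ZMod p, (X (some 1) + (l.val : (MvPolynomial (Option (Fin 4)) k)) * (X (some 0) * X none ^ (m + 1)))) ^ n₁))) (X (some 2) - rename (![none, some 1] : Fin 2 → Option (Fin 4)) (X 1 ^ (m + 1) * Polynomial.aeval (X 0 * X 1 : MvPolynomial (Fin 2) k) wl : MvPolynomial (Fin 2) k)) := by rw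 [hι₁, mul_one]
  -- ### the transition sections factor through `a` resp. `b`
  have hidx0 : consIndexEquiv mo (((dbar : ℕ) : ℤ), (0 : Π j : Fin mg, ZMod (mo j))) + consIndexEquiv mo (-((dbar : ℕ) : ℤ), (0 : Π j : Fin mg, ZMod (mo j))) = 0 := by
    have h : ((((dbar : ℕ) : ℤ), (0 : Π j : Fin mg, ZMod (mo j))) + (-((dbar : ℕ) : ℤ), (0 : Π j : Fin mg, ZMod (mo j)))) = 0 :=
      Prod.ext (add_neg_cancel _) (add_zero _)
    rw [← map_add, h, map_zero]
  have hinvd := FreeModel.map_invSelf_mem_mapGrading mo 𝒜 (fun i => algebraMap (MvPolynomial (Fin 4) k) (Localization.Away hh) (X ((![0, 1, 2] : Fin 3 → Fin 4) i))) (![m + 2, 1, m + 1] : Fin 3 → ℕ) hf dbar y hy Φ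
  have hsec : ∀ {z : ↥(cobordantAlgebra (fun i => algebraMap (MvPolynomial (Fin 4) k) (Localization.Away hh) (X ((![0, 1, 2] : Fin 3 → Fin 4) i))) (![m + 2, 1, m + 1] : Fin 3 → ℕ))}, z ∈ reesPiece 𝒜 (fun i => algebraMap (MvPolynomial (Fin 4) k) (Localization.Away hh) (X ((![0, 1, 2] : Fin 3 → Fin 4) i))) (![m + 2, 1, m + 1] : Fin 3 → ℕ) (((dbar : ℕ) : ℤ), (0 : Π j : Fin mg, ZMod (mo j))) →
      Φ (algebraMap ↥(cobordantAlgebra (fun i => algebraMap (MvPolynomial (Fin 4) k) (Localization.Away hh) (X ((![0, 1, 2] : Fin 3 → Fin 4) i))) (![m + 2, 1, m + 1] : Fin 3 → ℕ)) (ChartRing 𝒜 (fun i => algebraMap (MvPolynomial (Fin 4) k) (Localization.Away hh) (X ((![0, 1, 2] : Fin 3 → Fin 4) i))) (![m + 2, 1, m + 1] : Fin 3 → ℕ) dbar y hy) z) * Φ (IsLocalization.Away.invSelf (coverElement 𝒜 (fun i => algebraMap (MvPolynomial (Fin 4) k) (Localization.Away hh) (X ((![0, 1, 2] : Fin 3 →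 Fin 4) i))) (![m + 2, 1, m + 1] : Fin 3 → ℕ) dbar y hy)) ∈ mapGrading (chartNodeGrading mo 𝒜 (fun i => algebraMap (MvPolynomial (Fin 4) k) (Localization.Away hh) (X ((![0, 1, 2] : Fin 3 → Fin 4) i))) (![m + 2, 1, m + 1] : Fin 3 → ℕ) hf dbar y hy) Φ 0 := fun hz => by
    have h := SetLike.mul_mem_graded (FreeModel.map_algebraMap_mem_mapGrading mo 𝒜 (fun i => algebraMap (MvPolynomial (Fin 4) k) (Localization.Away hh) (X ((![0, 1, 2] : Fin 3 → Fin 4) i))) (![m + 2, 1, m + 1] : Fin 3 → ℕ) hf dbar y hy Φ hz) hinvd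
    rwa [hidx0] at h
  have hu1R : cobordantAlgebra.u' (fun i => algebraMap (MvPolynomial (Fin 4) k) (Localization.Away hh) (X ((![0, 1, 2] : Fin 3 → Fin 4) i))) (![m + 2, 1, m + 1] : Fin 3 → ℕ) 1 ∈ reesPiece 𝒜 (fun i => algebraMap (MvPolynomial (Fin 4) k) (Localization.Away hh) (X ((![0, 1, 2] : Fin 3 → Fin 4) i))) (![m + 2, 1, m + 1] : Fin 3 → ℕ) (((1 : ℕ) : ℤ), (0 : Π j : Fin mg, ZMod (mo j))) :=
    u'_mem_reesPiece 𝒜 (fun i => algebraMap (MvPolynomial (Fin 4) k) (Localization.Away hh) (X ((![0, 1, 2] : Fin 3 → Fin 4) i))) (δ := fun _ => 0) (![m + 2, 1, m + 1] : Fin 3 → ℕ) hf 1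
  -- (z0): `c₀ = u₀′^{n₀}`, `z0 = a^{n₀} · g0`
  have hn₀ : 0 < n₀ := by
    rcases Nat.eq_zero_or_pos n₀ with h | h
    · exfalso
      rw [h, mul_zero] at hd₀
      rw [hd₀] at hd₂
      exact absurd hd₂.symm (Nat.mul_pos (Nat.mul_pos (Nat.succ_pos m : 0 < m + 1) hp) hn₂).ne'
    · exact h
  have hg0R : cobordantAlgebra.u' (fun i => algebraMap (MvPolynomial (Fin 4) k) (Localization.Away hh) (X ((![0, 1, 2] : Fin 3 → Fin 4) i))) (![m + 2, 1, m + 1] : Fin 3 → ℕ) 1 ^ dbar ∈ reesPiece 𝒜 (fun i => algebraMap (MvPolynomial (Fin 4) k) (Localization.Away hh) (X ((![0, 1, 2] : Fin 3 → Fin 4) i))) (![m + 2, 1, m + 1] : Fin 3 → ℕ) (((dbar : ℕ) : ℤ), (0 : Π j : Fin mg, ZMod (mo j))) :=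
    ReesBigrading.reesPiece_natDeg_pow 𝒜 (fun i => algebraMap (MvPolynomial (Fin 4) k) (Localization.Away hh) (X ((![0, 1, 2] : Fin 3 → Fin 4) i))) (![m + 2, 1, m + 1] : Fin 3 → ℕ) hf hu1R dbar (one_mul dbar)
  obtain ⟨g0, hg0⟩ : ∃ g0 : Γ(M.V, W.1), g0 = eL.symm ⟨_, hsec hg0R⟩ := ⟨_, rfl⟩
  have heg0 : ((eL g0 : ↥(mapGrading (chartNodeGrading mo 𝒜 (fun i => algebraMap (MvPolynomial (Fin 4) k) (Localization.Away hh) (X ((![0, 1, 2] : Fin 3 → Fin 4) i))) (![m + 2, 1, m + 1] : Fin 3 → ℕ) hf dbar y hy) Φ 0)) : (Localization.Away (cobordantAlgebra.subst k (![m + 2, 1, m + 1, 0] : Fin 4 → ℕ) hh * (∏ l : ZMod p, (X (some 1) + (l.val : (MvPolynomial (Option (Fin 4)) k)) * (X (some 0) * X none ^ (m + 1)))) ^ n₁))) = (algebraMap (MvPolynomial (Option (Fin 4)) k) (Localization.Away (cobordantAlgebra.subst k (![m + 2, 1, m + 1, 0] : Fin 4 → ℕ) hh * (∏ l : ZMod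 p, (X (some 1) + (l.val : (MvPolynomial (Option (Fin 4)) k)) * (X (some 0) * X none ^ (m + 1)))) ^ n₁))) (X (some 1)) ^ dbar * Φ (IsLocalization.Away.invSelf (coverElement 𝒜 (fun i => algebraMap (MvPolynomial (Fin 4) k) (Localization.Away hh) (X ((![0, 1, 2] : Fin 3 → Fin 4) i))) (![m + 2, 1, m + 1] : Fin 3 → ℕ) dbar y hy)) := by
    rw [hg0, eL.apply_symm_apply]
    change Φ (algebraMap ↥(cobordantAlgebra (fun i => algebraMap (MvPolynomial (Fin 4) k) (Localization.Away hh) (X ((![0, 1, 2] : Fin 3 → Fin 4) i))) (![m + 2, 1, m + 1] : Fin 3 → ℕ)) (ChartRing 𝒜 (fun i => algebraMap (MvPolynomial (Fin 4) k) (Localization.Away hh) (X ((![0, 1, 2] : Fin 3 → Fin 4) i))) (![m + 2, 1, m + 1] : Fin 3 → ℕ) dbar y hy) (cobordantAlgebra.u' (fun i => algebraMap (MvPolynomial (Fin 4) k) (Localization.Away hh) (X ((![0, 1, 2] : Fin 3 → Fin 4) i))) (![m + 2, 1, m + 1] : Fin 3 → ℕ) 1 ^ dbar)) * _ = _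
    rw [map_pow, map_pow, hΦu 1]
    rfl
  have hez0 : ((eL z0 : ↥(mapGrading (chartNodeGrading mo 𝒜 (fun i => algebraMap (MvPolynomial (Fin 4) k) (Localization.Away hh) (X ((![0, 1, 2] : Fin 3 → Fin 4) i))) (![m + 2, 1, m + 1] : Fin 3 → ℕ) hf dbar y hy) Φ 0)) : (Localization.Away (cobordantAlgebra.subst k (![m + 2, 1, m + 1, 0] : Fin 4 → ℕ) hh * (∏ l : ZMod p, (X (some 1) + (l.val : (MvPolynomial (Option (Fin 4)) k)) * (X (some 0) * X none ^ (m + 1)))) ^ n₁))) = (algebraMap (MvPolynomial (Option (Fin 4)) k) (Localization.Away (cobordantAlgebra.subst k (![m + 2, 1, m + 1, 0] : Fin 4 → ℕ) hh * (∏ l : ZMod p, (X (some 1) + (l.val : (MvPolynomial (Option (Fin 4)) k)) * (X (some 0) * X none ^ (m + 1)))) ^ n₁))) (X (some 0)) ^ n₀ * Φ (IsLocalization.Away.invSelf (coverElement 𝒜 (fun i => algebraMap (MvPolynomial (Fin 4) k) (Localization.Away hh) (X ((![0, 1, 2] : Fin 3 → Fin 4) i))) (![m + 2, 1, m + 1]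 : Fin 3 → ℕ) dbar y hy)) := by
    rw [heLval, hz0, map_mul, map_pow, map_pow, hΦu 0]
    rfl
  have hX1ι₀ : (algebraMap (MvPolynomial (Option (Fin 4)) k) (Localization.Away (cobordantAlgebra.subst k (![m + 2, 1, m + 1, 0] : Fin 4 → ℕ) hh * (∏ l : ZMod p, (X (some 1) + (l.val : (MvPolynomial (Option (Fin 4)) k)) * (X (some 0) * X none ^ (m + 1)))) ^ n₁))) (X (some 1)) ^ dbar * ι₀ ^ n₀ = 1 := by rw [hd₀, pow_mul, ← mul_pow, hι₀, one_pow]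
  have hz0fac : z0 = a ^ n₀ * g0 := by
    apply eL.injective
    apply Subtype.ext
    rw [map_mul, map_pow, SetLike.GradeZero.coe_mul, SetLike.GradeZero.coe_pow, hea, heg0, hez0]
    calc (algebraMap (MvPolynomial (Option (Fin 4)) k) (Localization.Away (cobordantAlgebra.subst k (![m + 2, 1, m + 1, 0] : Fin 4 → ℕ) hh * (∏ l : ZMod p, (X (some 1) + (l.val : (MvPolynomial (Option (Fin 4)) k)) * (X (some 0) * X none ^ (m + 1)))) ^ n₁))) (X (some 0)) ^ n₀ * Φ (IsLocalization.Away.invSelf (coverElement 𝒜 (fun i => algebraMap (MvPolynomial (Fin 4) k) (Localization.Away hh) (X ((![0, 1, 2] : Fin 3 → Fin 4) i))) (![m + 2, 1, m + 1] : Fin 3 → ℕ) dbar y hy))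
        = (algebraMap (MvPolynomial (Option (Fin 4)) k) (Localization.Away (cobordantAlgebra.subst k (![m + 2, 1, m + 1, 0] : Fin 4 → ℕ) hh * (∏ l : ZMod p, (X (some 1) + (l.val : (MvPolynomial (Option (Fin 4)) k)) * (X (some 0) * X none ^ (m + 1)))) ^ n₁))) (X (some 0)) ^ n₀ * ((algebraMap (MvPolynomial (Option (Fin 4)) k) (Localization.Away (cobordantAlgebra.subst k (![m + 2, 1, m + 1, 0] : Fin 4 → ℕ) hh * (∏ l : ZMod p, (X (some 1) + (l.val : (MvPolynomial (Option (Fin 4)) k)) * (X (some 0) * X none ^ (m + 1)))) ^ n₁))) (X (some 1)) ^ dbar * ι₀ ^ n₀) * Φ (IsLocalization.Away.invSelf (coverElement 𝒜 (fun i => algebraMap (MvPolynomial (Fin 4) k) (Localization.Away hh) (X ((![0, 1, 2] : Fin 3 → Fin 4) i))) (![m + 2, 1, m + 1] : Fin 3 → ℕ) dbar y hy)) := by rw [hX1ι₀, mul_one]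
      _ = ((algebraMap (MvPolynomial (Option (Fin 4)) k) (Localization.Away (cobordantAlgebra.subst k (![m + 2, 1, m + 1, 0] : Fin 4 → ℕ) hh * (∏ l : ZMod p, (X (some 1) + (l.val : (MvPolynomial (Option (Fin 4)) k)) * (X (some 0) * X none ^ (m + 1)))) ^ n₁))) (X (some 0)) * ι₀) ^ n₀ * ((algebraMap (MvPolynomial (Option (Fin 4)) k) (Localization.Away (cobordantAlgebra.subst k (![m + 2, 1, m + 1, 0] : Fin 4 → ℕ) hh * (∏ l : ZMod p, (X (some 1) + (l.val : (MvPolynomial (Option (Fin 4)) k)) * (X (some 0) * X none ^ (m + 1)))) ^ n₁))) (X (some 1)) ^ dbar * Φ (IsLocalization.Away.invSelf (coverElement 𝒜 (fun i => algebraMap (MvPolynomial (Fin 4) k) (Localization.Away hh) (X ((![0, 1, 2] : Fin 3 → Fin 4) i))) (![m + 2, 1, m + 1] : Fin 3 → ℕ) dbar y hy))) := by ring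
  have hbo0 : ∀ v ∈ W.1, v ∈ M.V.basicOpen z0 → v ∈ M.V.basicOpen a := fun v _ hv => by
    rw [hz0fac, Scheme.basicOpen_mul, Scheme.basicOpen_pow _ _ hn₀] at hv
    exact hv.1
  -- (z2): `c₂ = (∏ⱼ σ_Rʲ t̂)^{n₂} = t̂ · c′`, `z2 = b · g2`
  have hTR : ∀ j : ℕ, (⇑(sigmaR (sigmaAway σ hσh) (fun i => algebraMap (MvPolynomial (Fin 4) k) (Localization.Away hh) (X ((![0, 1, 2] : Fin 3 → Fin 4) i))) (![m + 2, 1, m + 1] : Fin 3 → ℕ) hσJ hp hσpL))^[j] (⟨_, C_mul_T_mem_cobordantAlgebra _ _ ht⟩ : ↥(cobordantAlgebra (fun i => algebraMap (MvPolynomial (Fin 4) k) (Localization.Away hh) (X ((![0, 1, 2] : Fin 3 → Fin 4) i))) (![m + 2, 1, m + 1] : Fin 3 → ℕ))) ∈ reesPiece 𝒜 (fun i => algebraMap (MvPolynomial (Fin 4) k) (Localization.Away hh) (X ((![0, 1, 2] : Fin 3 → Fin 4) i))) (![m + 2, 1, m + 1] : Fin 3 → ℕ) ((((m + 1 : ℕ))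 : ℤ), (0 : Π j : Fin mg, ZMod (mo j))) := fun j =>
    (mem_reesPiece_iff 𝒜 (fun i => algebraMap (MvPolynomial (Fin 4) k) (Localization.Away hh) (X ((![0, 1, 2] : Fin 3 → Fin 4) i))) (![m + 2, 1, m + 1] : Fin 3 → ℕ)).mpr ⟨(⇑(sigmaAway σ hσh))^[j] (algebraMap (MvPolynomial (Fin 4) k) (Localization.Away hh) (X 2 - X 1 ^ (m + 1) * Polynomial.aeval (X 1 : MvPolynomial (Fin 4) k) wl : MvPolynomial (Fin 4) k)), h𝒜 _,
      QhAbs.qha_coe_sigmaR_iterate_tail (sigmaAway σ hσh) (fun i => algebraMap (MvPolynomial (Fin 4) k) (Localization.Away hh) (X ((![0, 1, 2] : Fin 3 → Fin 4) i))) (algebraMap (MvPolynomial (Fin 4) k) (Localization.Away hh) (X 2 - X 1 ^ (m + 1) * Polynomial.aeval (X 1 : MvPolynomial (Fin 4) k) wl : MvPolynomial (Fin 4) k)) (![m + 2, 1, m + 1] : Fin 3 → ℕ) (m + 1) ht hσJ hp hσpL j⟩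
  obtain ⟨p', hp'⟩ : ∃ p', p = p' + 1 := ⟨p - 1, (Nat.sub_add_cancel hp).symm⟩
  obtain ⟨n₂', hn₂'⟩ : ∃ n₂', n₂ = n₂' + 1 := ⟨n₂ - 1, (Nat.sub_add_cancel hn₂).symm⟩
  have hcard : (Finset.univ.erase (0 : ZMod p)).card = p' := by
    rw [Finset.card_erase_of_mem (Finset.mem_univ _), Finset.card_univ, ZMod.card, hp', Nat.add_sub_cancel]
  obtain ⟨N', hN'⟩ : ∃ N' : ↥(cobordantAlgebra (fun i => algebraMap (MvPolynomial (Fin 4) k) (Localization.Away hh) (X ((![0, 1, 2] : Fin 3 → Fin 4) i))) (![m + 2, 1, m + 1] : Fin 3 → ℕ)), N' = ∏ j ∈ Finset.univ.erase (0 : ZMod p), (⇑(sigmaR (sigmaAway σ hσh) (fun i => algebraMap (MvPolynomial (Fin 4) k) (Localization.Away hh) (X ((![0, 1, 2] : Fin 3 → Fin 4) i))) (![m + 2, 1, m + 1] : Fin 3 → ℕ) hσJ hp hσpL))^[j.val] (⟨_, C_mul_T_mem_cobordantAlgebra _ _ ht⟩ : ↥(cobordantAlgebra (fun i => algebraMap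 (MvPolynomial (Fin 4) k) (Localization.Away hh) (X ((![0, 1, 2] : Fin 3 → Fin 4) i))) (![m + 2, 1, m + 1] : Fin 3 → ℕ))) := ⟨_, rfl⟩
  have hNsplit : (∏ j : ZMod p, (⇑(sigmaR (sigmaAway σ hσh) (fun i => algebraMap (MvPolynomial (Fin 4) k) (Localization.Away hh) (X ((![0, 1, 2] : Fin 3 → Fin 4) i))) (![m + 2, 1, m + 1] : Fin 3 → ℕ) hσJ hp hσpL))^[j.val] (⟨_, C_mul_T_mem_cobordantAlgebra _ _ ht⟩ : ↥(cobordantAlgebra (fun i => algebraMap (MvPolynomial (Fin 4) k) (Localization.Away hh) (X ((![0, 1, 2] : Fin 3 → Fin 4) i))) (![m + 2, 1, m + 1] : Fin 3 → ℕ)))) = (⟨_, C_mul_T_mem_cobordantAlgebra _ _ ht⟩ : ↥(cobordantAlgebra (fun i => algebraMap (MvPolynomial (Fin 4) k) (Localization.Away hh) (X ((![0, 1, 2] : Fin 3 → Fin 4) i))) (![m + 2, 1, m + 1] : Fin 3 → ℕ))) * N' := by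
    rw [hN', ← Finset.mul_prod_erase Finset.univ (fun j : ZMod p => (⇑(sigmaR (sigmaAway σ hσh) (fun i => algebraMap (MvPolynomial (Fin 4) k) (Localization.Away hh) (X ((![0, 1, 2] : Fin 3 → Fin 4) i))) (![m + 2, 1, m + 1] : Fin 3 → ℕ) hσJ hp hσpL))^[j.val] (⟨_, C_mul_T_mem_cobordantAlgebra _ _ ht⟩ : ↥(cobordantAlgebra (fun i => algebraMap (MvPolynomial (Fin 4) k) (Localization.Away hh) (X ((![0, 1, 2] : Fin 3 → Fin 4) i))) (![m + 2, 1, m + 1] : Fin 3 → ℕ)))) (Finset.mem_univ (0 : ZMod p)), ZMod.val_zero,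
      Function.iterate_zero_apply]
  obtain ⟨c', hc'⟩ : ∃ c' : ↥(cobordantAlgebra (fun i => algebraMap (MvPolynomial (Fin 4) k) (Localization.Away hh) (X ((![0, 1, 2] : Fin 3 → Fin 4) i))) (![m + 2, 1, m + 1] : Fin 3 → ℕ)), c' = (⟨_, C_mul_T_mem_cobordantAlgebra _ _ ht⟩ : ↥(cobordantAlgebra (fun i => algebraMap (MvPolynomial (Fin 4) k) (Localization.Away hh) (X ((![0, 1, 2] : Fin 3 → Fin 4) i))) (![m + 2, 1, m + 1] : Fin 3 → ℕ))) ^ n₂' * N' ^ n₂ := ⟨_, rfl⟩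
  have hc2fac : (∏ j : ZMod p, (⇑(sigmaR (sigmaAway σ hσh) (fun i => algebraMap (MvPolynomial (Fin 4) k) (Localization.Away hh) (X ((![0, 1, 2] : Fin 3 → Fin 4) i))) (![m + 2, 1, m + 1] : Fin 3 → ℕ) hσJ hp hσpL))^[j.val] (⟨_, C_mul_T_mem_cobordantAlgebra _ _ ht⟩ : ↥(cobordantAlgebra (fun i => algebraMap (MvPolynomial (Fin 4) k) (Localization.Away hh) (X ((![0, 1, 2] : Fin 3 → Fin 4) i))) (![m + 2, 1, m + 1] : Fin 3 → ℕ)))) ^ n₂ = (⟨_, C_mul_T_mem_cobordantAlgebra _ _ ht⟩ : ↥(cobordantAlgebra (fun i => algebraMap (MvPolynomial (Fin 4) k) (Localization.Away hh) (X ((![0, 1, 2] : Fin 3 → Fin 4) i))) (![m + 2, 1, m + 1] : Fin 3 → ℕ))) * c' := by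
    rw [hNsplit, hc', mul_pow, hn₂', pow_succ]
    ring
  have hN'R : N' ∈ reesPiece 𝒜 (fun i => algebraMap (MvPolynomial (Fin 4) k) (Localization.Away hh) (X ((![0, 1, 2] : Fin 3 → Fin 4) i))) (![m + 2, 1, m + 1] : Fin 3 → ℕ) (((((m + 1) * p' : ℕ)) : ℤ), (0 : Π j : Fin mg, ZMod (mo j))) := by
    rw [hN']
    exact ReesBigrading.reesPiece_natDeg_prod 𝒜 (fun i => algebraMap (MvPolynomial (Fin 4) k) (Localization.Away hh) (X ((![0, 1, 2] : Fin 3 → Fin 4) i))) (![m + 2, 1, m + 1] : Fin 3 → ℕ) hf _ (fun j _ => hTR j.val) (congrArg ((m + 1) * ·) hcard)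
  have hT0R : (⟨_, C_mul_T_mem_cobordantAlgebra _ _ ht⟩ : ↥(cobordantAlgebra (fun i => algebraMap (MvPolynomial (Fin 4) k) (Localization.Away hh) (X ((![0, 1, 2] : Fin 3 → Fin 4) i))) (![m + 2, 1, m + 1] : Fin 3 → ℕ))) ∈ reesPiece 𝒜 (fun i => algebraMap (MvPolynomial (Fin 4) k) (Localization.Away hh) (X ((![0, 1, 2] : Fin 3 → Fin 4) i))) (![m + 2, 1, m + 1] : Fin 3 → ℕ) ((((m + 1 : ℕ)) : ℤ), (0 : Π j : Fin mg, ZMod (mo j))) := by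
    have h := hTR 0
    rwa [Function.iterate_zero_apply] at h
  have hc'R : cobordantAlgebra.u' (fun i => algebraMap (MvPolynomial (Fin 4) k) (Localization.Away hh) (X ((![0, 1, 2] : Fin 3 → Fin 4) i))) (![m + 2, 1, m + 1] : Fin 3 → ℕ) 1 ^ (m + 1) * c' ∈ reesPiece 𝒜 (fun i => algebraMap (MvPolynomial (Fin 4) k) (Localization.Away hh) (X ((![0, 1, 2] : Fin 3 → Fin 4) i))) (![m + 2, 1, m + 1] : Fin 3 → ℕ) (((dbar : ℕ) : ℤ), (0 : Π j : Fin mg, ZMod (mo j))) := by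
    rw [hc']
    refine ReesBigrading.reesPiece_natDeg_mul 𝒜 (fun i => algebraMap (MvPolynomial (Fin 4) k) (Localization.Away hh) (X ((![0, 1, 2] : Fin 3 → Fin 4) i))) (![m + 2, 1, m + 1] : Fin 3 → ℕ) hf (ReesBigrading.reesPiece_natDeg_pow 𝒜 (fun i => algebraMap (MvPolynomial (Fin 4) k) (Localization.Away hh) (X ((![0, 1, 2] : Fin 3 → Fin 4) i))) (![m + 2, 1, m + 1] : Fin 3 → ℕ) hf hu1R (m + 1) rfl)
      (ReesBigrading.reesPiece_natDeg_mul 𝒜 (fun i => algebraMap (MvPolynomial (Fin 4) k) (Localization.Away hh) (X ((![0, 1, 2] : Fin 3 → Fin 4) i))) (![m + 2, 1, m + 1] : Fin 3 → ℕ) hf (ReesBigrading.reesPiece_natDeg_pow 𝒜 (fun i => algebraMap (MvPolynomial (Fin 4) k) (Localization.Away hh) (X ((![0, 1, 2] : Fin 3 → Fin 4) i))) (![m + 2, 1, m + 1] : Fin 3 → ℕ) hf hT0R n₂' rfl)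
        (ReesBigrading.reesPiece_natDeg_pow 𝒜 (fun i => algebraMap (MvPolynomial (Fin 4) k) (Localization.Away hh) (X ((![0, 1, 2] : Fin 3 → Fin 4) i))) (![m + 2, 1, m + 1] : Fin 3 → ℕ) hf hN'R n₂ rfl) rfl) ?_
    rw [hd₂, hp', hn₂']
    ring
  obtain ⟨g2, hg2⟩ : ∃ g2 : Γ(M.V, W.1), g2 = eL.symm ⟨_, hsec hc'R⟩ := ⟨_, rfl⟩
  have heg2 : ((eL g2 : ↥(mapGrading (chartNodeGrading mo 𝒜 (fun i => algebraMap (MvPolynomial (Fin 4) k) (Localization.Away hh) (X ((![0, 1, 2] : Fin 3 → Fin 4) i))) (![m + 2, 1, m + 1] : Fin 3 → ℕ) hf dbar y hy) Φ 0)) : (Localization.Away (cobordantAlgebra.subst k (![m + 2, 1, m + 1, 0] : Fin 4 → ℕ) hh * (∏ l : ZMod p, (X (some 1) + (l.val : (MvPolynomial (Option (Fin 4)) k)) * (X (some 0) * X none ^ (m + 1)))) ^ n₁))) = (algebraMap (MvPolynomial (Option (Fin 4)) k) (Localization.Away (cobordantAlgebra.subst k (![m + 2, 1, m + 1, 0]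 : Fin 4 → ℕ) hh * (∏ l : ZMod p, (X (some 1) + (l.val : (MvPolynomial (Option (Fin 4)) k)) * (X (some 0) * X none ^ (m + 1)))) ^ n₁))) (X (some 1)) ^ (m + 1) * Φ (algebraMap ↥(cobordantAlgebra (fun i => algebraMap (MvPolynomial (Fin 4) k) (Localization.Away hh) (X ((![0, 1, 2] : Fin 3 → Fin 4) i))) (![m + 2, 1, m + 1] : Fin 3 → ℕ)) (ChartRing 𝒜 (fun i => algebraMap (MvPolynomial (Fin 4) k) (Localization.Away hh) (X ((![0, 1, 2] : Fin 3 → Fin 4) i))) (![m + 2, 1, m + 1] : Fin 3 → ℕ) dbar y hy) c') * Φ (IsLocalization.Away.invSelf (coverElement 𝒜 (fun i => algebraMap (MvPolynomial (Fin 4) k) (Localization.Away hh) (X ((![0, 1, 2] : Fin 3 → Fin 4) i))) (![m + 2, 1, m + 1] : Fin 3 → ℕ) dbar y hy)) := by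
    rw [hg2, eL.apply_symm_apply]
    change Φ (algebraMap ↥(cobordantAlgebra (fun i => algebraMap (MvPolynomial (Fin 4) k) (Localization.Away hh) (X ((![0, 1, 2] : Fin 3 → Fin 4) i))) (![m + 2, 1, m + 1] : Fin 3 → ℕ)) (ChartRing 𝒜 (fun i => algebraMap (MvPolynomial (Fin 4) k) (Localization.Away hh) (X ((![0, 1, 2] : Fin 3 → Fin 4) i))) (![m + 2, 1, m + 1] : Fin 3 → ℕ) dbar y hy) (cobordantAlgebra.u' (fun i => algebraMap (MvPolynomial (Fin 4) k) (Localization.Away hh) (X ((![0, 1, 2] : Fin 3 → Fin 4) i))) (![m + 2, 1, m + 1] : Fin 3 → ℕ) 1 ^ (m + 1) * c')) * _ = _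
    rw [map_mul, map_mul, map_pow, map_pow, hΦu 1]
    rfl
  have hez2 : ((eL z2 : ↥(mapGrading (chartNodeGrading mo 𝒜 (fun i => algebraMap (MvPolynomial (Fin 4) k) (Localization.Away hh) (X ((![0, 1, 2] : Fin 3 → Fin 4) i))) (![m + 2, 1, m + 1] : Fin 3 → ℕ) hf dbar y hy) Φ 0)) : (Localization.Away (cobordantAlgebra.subst k (![m + 2, 1, m + 1, 0] : Fin 4 → ℕ) hh * (∏ l : ZMod p, (X (some 1) + (l.val : (MvPolynomial (Option (Fin 4)) k)) * (X (some 0) * X none ^ (m + 1)))) ^ n₁))) = (algebraMap (MvPolynomial (Option (Fin 4)) k) (Localization.Away (cobordantAlgebra.subst k (![m + 2, 1, m + 1, 0] : Fin 4 → ℕ) hh * (∏ l : ZMod p, (X (some 1) + (l.val : (MvPolynomial (Option (Fin 4)) k)) * (X (some 0) * X none ^ (m + 1)))) ^ n₁))) (X (some 2) - rename (![none, some 1] : Fin 2 → Option (Fin 4)) (X 1 ^ (m + 1) * Polynomial.aeval (X 0 * X 1 : MvPolynomial (Fin 2) k) wl : MvPolynomial (Fin 2) k)) * Φ (algebraMap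 ↥(cobordantAlgebra (fun i => algebraMap (MvPolynomial (Fin 4) k) (Localization.Away hh) (X ((![0, 1, 2] : Fin 3 → Fin 4) i))) (![m + 2, 1, m + 1] : Fin 3 → ℕ)) (ChartRing 𝒜 (fun i => algebraMap (MvPolynomial (Fin 4) k) (Localization.Away hh) (X ((![0, 1, 2] : Fin 3 → Fin 4) i))) (![m + 2, 1, m + 1] : Fin 3 → ℕ) dbar y hy) c') * Φ (IsLocalization.Away.invSelf (coverElement 𝒜 (fun i => algebraMap (MvPolynomial (Fin 4) k) (Localization.Away hh) (X ((![0, 1, 2] : Fin 3 → Fin 4) i))) (![m + 2, 1, m + 1] : Fin 3 → ℕ) dbar y hy)) := by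
    rw [heLval, hz2, hc2fac, map_mul, map_mul, map_mul, hφeq]
  have hz2fac : z2 = b * g2 := by
    apply eL.injective
    apply Subtype.ext
    rw [map_mul, SetLike.GradeZero.coe_mul, heb, heg2, hez2]
    calc (algebraMap (MvPolynomial (Option (Fin 4)) k) (Localization.Away (cobordantAlgebra.subst k (![m + 2, 1, m + 1, 0] : Fin 4 → ℕ) hh * (∏ l : ZMod p, (X (some 1) + (l.val : (MvPolynomial (Option (Fin 4)) k)) * (X (some 0) * X none ^ (m + 1)))) ^ n₁))) (X (some 2) - rename (![none, some 1] : Fin 2 → Option (Fin 4)) (X 1 ^ (m + 1) * Polynomial.aeval (X 0 * X 1 : MvPolynomial (Fin 2) k) wl : MvPolynomial (Fin 2) k)) * Φ (algebraMap ↥(cobordantAlgebra (fun i => algebraMap (MvPolynomial (Fin 4) k) (Localization.Away hh) (X ((![0, 1, 2] : Fin 3 → Fin 4) i))) (![m + 2, 1, m + 1] : Fin 3 → ℕ)) (ChartRing 𝒜 (fun i => algebraMap (MvPolynomial (Fin 4) k) (Localization.Away hh) (X ((![0, 1, 2] : Fin 3 → Fin 4) i))) (![m + 2, 1, m + 1]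 : Fin 3 → ℕ) dbar y hy) c') * Φ (IsLocalization.Away.invSelf (coverElement 𝒜 (fun i => algebraMap (MvPolynomial (Fin 4) k) (Localization.Away hh) (X ((![0, 1, 2] : Fin 3 → Fin 4) i))) (![m + 2, 1, m + 1] : Fin 3 → ℕ) dbar y hy))
        = (algebraMap (MvPolynomial (Option (Fin 4)) k) (Localization.Away (cobordantAlgebra.subst k (![m + 2, 1, m + 1, 0] : Fin 4 → ℕ) hh * (∏ l : ZMod p, (X (some 1) + (l.val : (MvPolynomial (Option (Fin 4)) k)) * (X (some 0) * X none ^ (m + 1)))) ^ n₁))) (X (some 2) - rename (![none, some 1] : Fin 2 → Option (Fin 4)) (X 1 ^ (m + 1) * Polynomial.aeval (X 0 * X 1 : MvPolynomial (Fin 2) k) wl : MvPolynomial (Fin 2) k)) * ((algebraMap (MvPolynomial (Option (Fin 4)) k) (Localization.Away (cobordantAlgebra.subst k (![m + 2, 1, m + 1, 0] : Fin 4 → ℕ) hh * (∏ l : ZMod p, (X (some 1) + (l.val : (MvPolynomial (Option (Fin 4)) k)) * (X (some 0) * X none ^ (m + 1)))) ^ n₁))) (X (some 1)) ^ (m + 1)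 * ι₁) * Φ (algebraMap ↥(cobordantAlgebra (fun i => algebraMap (MvPolynomial (Fin 4) k) (Localization.Away hh) (X ((![0, 1, 2] : Fin 3 → Fin 4) i))) (![m + 2, 1, m + 1] : Fin 3 → ℕ)) (ChartRing 𝒜 (fun i => algebraMap (MvPolynomial (Fin 4) k) (Localization.Away hh) (X ((![0, 1, 2] : Fin 3 → Fin 4) i))) (![m + 2, 1, m + 1] : Fin 3 → ℕ) dbar y hy) c') * Φ (IsLocalization.Away.invSelf (coverElement 𝒜 (fun i => algebraMap (MvPolynomial (Fin 4) k) (Localization.Away hh) (X ((![0, 1, 2] : Fin 3 → Fin 4) i))) (![m + 2, 1, m + 1] : Fin 3 → ℕ) dbar y hy)) := by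
          rw [hι₁, mul_one]
      _ = (algebraMap (MvPolynomial (Option (Fin 4)) k) (Localization.Away (cobordantAlgebra.subst k (![m + 2, 1, m + 1, 0] : Fin 4 → ℕ) hh * (∏ l : ZMod p, (X (some 1) + (l.val : (MvPolynomial (Option (Fin 4)) k)) * (X (some 0) * X none ^ (m + 1)))) ^ n₁))) (X (some 2) - rename (![none, some 1] : Fin 2 → Option (Fin 4)) (X 1 ^ (m + 1) * Polynomial.aeval (X 0 * X 1 : MvPolynomial (Fin 2) k) wl : MvPolynomial (Fin 2) k)) * ι₁ * ((algebraMap (MvPolynomial (Option (Fin 4)) k) (Localization.Away (cobordantAlgebra.subst k (![m + 2, 1, m + 1, 0] : Fin 4 → ℕ) hh * (∏ l : ZMod p, (X (some 1) + (l.val : (MvPolynomial (Option (Fin 4)) k)) * (X (some 0) * X none ^ (m + 1)))) ^ n₁))) (X (some 1)) ^ (m + 1) * Φ (algebraMap ↥(cobordantAlgebra (fun i => algebraMap (MvPolynomial (Fin 4) k) (Localization.Away hh) (X ((![0, 1, 2] : Fin 3 → Fin 4) i))) (![m + 2, 1, m + 1] : Fin 3 → ℕ)) (ChartRing 𝒜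 (fun i => algebraMap (MvPolynomial (Fin 4) k) (Localization.Away hh) (X ((![0, 1, 2] : Fin 3 → Fin 4) i))) (![m + 2, 1, m + 1] : Fin 3 → ℕ) dbar y hy) c') * Φ (IsLocalization.Away.invSelf (coverElement 𝒜 (fun i => algebraMap (MvPolynomial (Fin 4) k) (Localization.Away hh) (X ((![0, 1, 2] : Fin 3 → Fin 4) i))) (![m + 2, 1, m + 1] : Fin 3 → ℕ) dbar y hy))) := by ring
  have hbo2 : ∀ v ∈ W.1, v ∈ M.V.basicOpen z2 → v ∈ M.V.basicOpen b := fun v _ hv => by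
    rw [hz2fac, Scheme.basicOpen_mul] at hv
    exact hv.1
  -- ### the member chart and its section form
  refine ⟨a, b, hrel_a, hrel_b, hbo0, hbo2, d₀, hver.1, fun l hl => ?_⟩
  obtain ⟨𝒦₀, hprin, -, -, hres⟩ := exists_principalCentreChart_of_graphChartAway σ hC h0 h1 h2 (X 2 - X 1 ^ (m + 1) * Polynomial.aeval (X 1 : MvPolynomial (Fin 4) k) wl : MvPolynomial (Fin 4) k) h3 (![m + 2, 1, m + 1] : Fin 3 → ℕ) (m + 1) hw0 (GraphTail.graphTail_mem m wl) hh hσh hp hσpL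
    hσJ mo 𝒜 hf ht0A y hy hσy (cobordantAlgebra.subst k (![m + 2, 1, m + 1, 0] : Fin 4 → ℕ) hh * (∏ l : ZMod p, (X (some 1) + (l.val : (MvPolynomial (Option (Fin 4)) k)) * (X (some 0) * X none ^ (m + 1)))) ^ n₁) hq0 Φ hΦa hΦs hΦu hτq (X 1 ^ (m + 1) * Polynomial.aeval (X 0 * X 1 : MvPolynomial (Fin 2) k) wl : MvPolynomial (Fin 2) k) hT' hGu hu' M W hW E htame hE d₀ l hl hver
  refine ⟨𝒦₀, hprin, fun U hU n => ?_⟩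
  rw [CoarseChart.filtration_eq_weightedFiltration_sections 𝒦₀ W.1 (mapGrading (chartNodeGrading mo 𝒜 (fun i => algebraMap (MvPolynomial (Fin 4) k) (Localization.Away hh) (X ((![0, 1, 2] : Fin 3 → Fin 4) i))) (![m + 2, 1, m + 1] : Fin 3 → ℕ) hf dbar y hy) Φ) eL (![(algebraMap (MvPolynomial (Option (Fin 4)) k) (Localization.Away (cobordantAlgebra.subst k (![m + 2, 1, m + 1, 0] : Fin 4 → ℕ) hh * (∏ l : ZMod p, (X (some 1) + (l.val : (MvPolynomial (Option (Fin 4)) k)) * (X (some 0) * X none ^ (m + 1)))) ^ n₁))) (X (some 0)), (algebraMap (MvPolynomial (Option (Fin 4)) k) (Localization.Away (cobordantAlgebra.subst k (![m + 2, 1, m + 1, 0] : Fin 4 → ℕ) hh * (∏ l : ZMod p, (X (some 1) + (l.val : (MvPolynomial (Option (Fin 4)) k)) * (X (some 0) * X none ^ (m + 1)))) ^ n₁))) (X (some 2) - rename (![none, some 1] : Fin 2 → Option (Fin 4)) (X 1 ^ (m + 1) * Polynomial.aeval (X 0 * X 1 : MvPolynomial (Fin 2) k) wl : MvPolynomial (Fin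 2) k))] : Fin 2 → (Localization.Away (cobordantAlgebra.subst k (![m + 2, 1, m + 1, 0] : Fin 4 → ℕ) hh * (∏ l : ZMod p, (X (some 1) + (l.val : (MvPolynomial (Option (Fin 4)) k)) * (X (some 0) * X none ^ (m + 1)))) ^ n₁))) ![2, 1] (by rw [heL]; exact hres) ![a, b] ?_ U hU n]
  intro i
  fin_cases i
  · change Associated ((algebraMap (MvPolynomial (Option (Fin 4)) k) (Localization.Away (cobordantAlgebra.subst k (![m + 2, 1, m + 1, 0] : Fin 4 → ℕ) hh * (∏ l : ZMod p, (X (some 1) + (l.val : (MvPolynomial (Option (Fin 4)) k)) * (X (some 0) * X none ^ (m + 1)))) ^ n₁))) (X (some 0))) (((eL a : ↥(mapGrading (chartNodeGrading mo 𝒜 (fun i => algebraMap (MvPolynomial (Fin 4) k) (Localization.Away hh) (X ((![0, 1, 2] : Fin 3 → Fin 4) i))) (![m + 2, 1, m + 1] : Fin 3 → ℕ) hf dbar y hy) Φ 0)) : (Localization.Away (cobordantAlgebra.subst k (![m + 2, 1, m + 1, 0] : Fin 4 → ℕ) hh * (∏ l : ZMod p, (X (some 1) + (l.val : (MvPolynomial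 (Option (Fin 4)) k)) * (X (some 0) * X none ^ (m + 1)))) ^ n₁))))
    rw [hea]
    exact associated_mul_unit_right _ _ hι₀u
  · change Associated ((algebraMap (MvPolynomial (Option (Fin 4)) k) (Localization.Away (cobordantAlgebra.subst k (![m + 2, 1, m + 1, 0] : Fin 4 → ℕ) hh * (∏ l : ZMod p, (X (some 1) + (l.val : (MvPolynomial (Option (Fin 4)) k)) * (X (some 0) * X none ^ (m + 1)))) ^ n₁))) (X (some 2) - rename (![none, some 1] : Fin 2 → Option (Fin 4)) (X 1 ^ (m + 1) * Polynomial.aeval (X 0 * X 1 : MvPolynomial (Fin 2) k) wl : MvPolynomial (Fin 2) k))) (((eL b : ↥(mapGrading (chartNodeGrading mo 𝒜 (fun i => algebraMap (MvPolynomial (Fin 4) k) (Localization.Away hh) (X ((![0, 1, 2] : Fin 3 → Fin 4) i))) (![m + 2, 1, m + 1] : Fin 3 → ℕ) hf dbar y hy) Φ 0)) : (Localization.Away (cobordantAlgebra.subst k (![m + 2, 1, m + 1, 0] : Fin 4 → ℕ) hh * (∏ l : ZMod p, (X (some 1) + (l.val : (MvPolynomial (Option (Fin 4)) k)) * (X (some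 0) * X none ^ (m + 1)))) ^ n₁))))
    rw [heb]
    exact associated_mul_unit_right _ _ hι₁u

end Summit.ResolutionOfSingularities.ResolutionOfSingularities.Theorems.WildQuotientResolution.S1.GameFrame.GModel

end
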